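import Literature.ModelTheory.FiniteModelTheory.CFIMatchingGraphs
import Literature.Probability.LatticeModels.PerfectMatchingCount
import Mathlib.Data.Fintype.Perm
import HarnessLib

/-!
# The number of perfect matchings of the CFI matching graphs (Dawar–Wilsenach 2025, §7.2,
# Lemmas 7.5–7.9 and the counting half of the proof of Theorem 7.2)

Everything PROVED; no named facts. For a 3-regular rotation map `R : RotGraph M 3` without
half-edges (`NoFixed`) which is 2-dart-connected (`TwoLeaving`; the printed "2-connected"), the
CFI matching graphs `M(R, 0)` (`= X(Γ)`) and `M(R, 1_x)` (`= X̃_x(Γ)`) of `CFIMatchingGraphs.lean`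
have DIFFERENT numbers of perfect matchings (`card_perfectMatchings_ne`); precisely
`μ(M(R,0)) − μ(M(R,1_x)) = 2^M · |Ker ∂| · (±1)` (`card_PMI_sub`).

## The printed argument (pp. 21–24) and its formalisation

Perfect matchings are counted through their partner maps (adjacent fixed-point-free involutions,
`PMI`; `card_perfectMatchings_eq_card_adjInvolutions`).
* PROJECTIONS (p. 21): `p(δ) ∈ {0,1,2}` = the number of ends `(δ, a)` matched INWARD (into the
  gadget of `δ`); `p(δ) + p(rot δ) = 2` (the link of the edge takes exactly one of the two ends with
  the same `a`) and `∑_j p(w, j) = 3` (`proj_add_proj_rot`, `sum_proj`); UNIFORM = all `p = 1`.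
* LEMMA 7.5 (`card_nonuniform_eq`): a non-uniform matching has a dart `δ₂` with `p = 2`; the
  gauge transformation along a walk from the base of `δ₂` to `x` avoiding the edge of `δ₂`
  (2-dart-connectivity, `reachable_of_twoLeaving`), twisted at `δ₂`, is an isomorphism off the
  two link edges at the ends `(rot δ₂, ·)` — which such a matching does not use — and conjugation by
  it (`twist`) is an involutive bijection between the non-uniform matchings of `M(R, c)` and of
  `M(R, c + 1_x)` preserving all projections.
* ORIENTATIONS (pp. 21–23): a uniform matching induces the labelling `lab δ` = the index of the
  inward end of `δ`, anti-symmetric on edges (an orientation); the uniform matchings with a given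
  labelling `L` correspond to independent choices of LOCAL MATCHINGS at every vertex (`card_UL`,
  the bijection `locOf`/`ofLoc`), and the local count is `4` or `2` according to the parity of the
  labels at the vertex against its charge (`card_LocF`, by `decide`; the printed subgraphs `S`, `T`
  with "exactly four" resp. "exactly two" perfect matchings).
* LEMMAS 7.6–7.8 (`sum_bd_eq_zero`, `exists_sym_bd_eq`, `card_fibre`): orientations form a torsor
  over the edge space `Sym`; the boundary `∂ : Sym → 𝔽₂^V` has image the even-total vectors
  (connectivity, pairing the support along walk gauges) and all non-empty fibres have `|Ker ∂|`
  elements.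
* LEMMA 7.9 (`sum_Fx_fixed_total`, signed form): `∑_{u : ∑u = π} (−1)^{u x} ∏_{w ≠ x} (2 − u w) = ±1`,
  by summing the product formula over all `u` with and without the sign character.
* ASSEMBLY (`card_PMI_sub`, `card_PMI_ne`): the difference of the uniform counts is
  `2^M ∑_L (−1)^{odd_L(x)} ∏_{w≠x}(2 − odd_L(w)) = 2^M |Ker ∂| (±1) ≠ 0`; the non-uniform counts agree.

## References

* A. Dawar, G. Wilsenach, *Symmetric arithmetic circuits*, Theory of Computing 21 (2025), §7.2:
  Non-Uniform Matchings and Lemma 7.5 (p. 21), Orientations and Lemmas 7.6–7.8 (pp. 21–23),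
  Matchings in gadgets (p. 23), Uniform matchings and Lemma 7.9, Proof of Theorem 7.2 (p. 24).
  Read: `lit read doi:10.4086/toc.2025.v021a014 --pages 19-24`.
-/

noncomputable section

open scoped Classical

namespace Literature.ModelTheory.FiniteModelTheory.CFIMatching

open Finset
open Literature.Computability.Complexity.Expander (RotGraph)
open TseitinColouring (EdgeExpansion Dart terr comp bd)

variable {M : ℕ} (R : RotGraph M 3)

/-! ### Vertex constructors and adjacency in `M(R, c)` -/

/-- Inner vertex. [folklore] -/
abbrev inn (w : Fin M) (S : Fin 2 → ZMod 2) : MVert M := .inl (w, S)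
/-- Balance vertex. [folklore] -/
abbrev bal (w : Fin M) : MVert M := .inr (.inl w)
/-- End vertex. [folklore] -/
abbrev en (δ : Dart M 3) (a : ZMod 2) : MVert M := .inr (.inr (.inl (δ, a)))
/-- Link vertex. [folklore] -/
abbrev lk (δ : Dart M 3) (a : ZMod 2) : MVert M := .inr (.inr (.inr (δ, a)))

variable {R} {c : Fin M → ZMod 2}

/-- Adjacency in `M(R, c)` is the symmetrised generating relation. [folklore] -/
theorem madj_iff {x y : MVert M} : (mgraph R c).Adj x y ↔ x ≠ y ∧ (mrel R c x y ∨ mrel R c y x) :=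
  SimpleGraph.fromRel_adj _ _ _

/-- End–inner adjacency. [cite: DawarWilsenach2025, §7.2 ("the edge {e₁, v_S} if e ∈ S and {e₀, v_S} otherwise")] -/
@[simp] theorem adj_en_inn {δ : Dart M 3} {a : ZMod 2} {w : Fin M} {S : Fin 2 → ZMod 2} :
    (mgraph R c).Adj (en δ a) (inn w S) ↔ δ.1 = w ∧ bit (c w) S δ.2 = a := by
  rw [madj_iff]; simp [mrel]

/-- Inner–end adjacency. [folklore] -/
@[simp] theorem adj_inn_en {δ : Dart M 3} {a : ZMod 2} {w : Fin M} {S : Fin 2 → ZMod 2} :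
    (mgraph R c).Adj (inn w S) (en δ a) ↔ δ.1 = w ∧ bit (c w) S δ.2 = a := by
  rw [SimpleGraph.adj_comm]; exact adj_en_inn

/-- Balance–inner adjacency. [cite: DawarWilsenach2025, §7.2 ("the neighbours of v_b are exactly the four vertices v_S")] -/
@[simp] theorem adj_bal_inn {w w' : Fin M} {S : Fin 2 → ZMod 2} : (mgraph R c).Adj (bal w) (inn w' S) ↔ w = w' := by
  rw [madj_iff]; simp [mrel]

/-- Inner–balance adjacency. [folklore] -/
@[simp] theorem adj_inn_bal {w w' : Fin M} {S : Fin 2 → ZMod 2} : (mgraph R c).Adj (inn w' S) (bal w) ↔ w = w' := by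
  rw [SimpleGraph.adj_comm]; exact adj_bal_inn

/-- Link–end adjacency. [folklore] -/
@[simp] theorem adj_lk_en {δ δ' : Dart M 3} {a a' : ZMod 2} :
    (mgraph R c).Adj (lk δ a) (en δ' a') ↔ Canon R δ ∧ a' = a ∧ (δ' = δ ∨ δ' = R.rot δ) := by
  rw [madj_iff]; simp [mrel]

/-- End–link adjacency. [folklore] -/
@[simp] theorem adj_en_lk {δ δ' : Dart M 3} {a a' : ZMod 2} :
    (mgraph R c).Adj (en δ' a') (lk δ a) ↔ Canon R δ ∧ a' = a ∧ (δ' = δ ∨ δ' = R.rot δ) := by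
  rw [SimpleGraph.adj_comm]; exact adj_lk_en

/-- Link–link adjacency (the isolated edges of non-canonical darts). [folklore] -/
@[simp] theorem adj_lk_lk {δ δ' : Dart M 3} {a a' : ZMod 2} :
    (mgraph R c).Adj (lk δ a) (lk δ' a') ↔ ¬ Canon R δ ∧ δ' = δ ∧ a' = a + 1 := by
  rw [madj_iff]
  simp only [mrel, ne_eq, Sum.inr.injEq, Prod.mk.injEq]
  constructor
  · rintro ⟨hne, ⟨hc, rfl, rfl⟩ | ⟨hc, rfl, rfl⟩⟩
    · exact ⟨hc, rfl, rfl⟩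
    · exact ⟨hc, rfl, by rw [add_assoc, zmod2_add_self, add_zero]⟩
  · rintro ⟨hc, rfl, rfl⟩
    exact ⟨fun h => fin2_add_one_ne a h.2.symm, Or.inl ⟨hc, rfl, rfl⟩⟩

/-- No inner–inner edges. [folklore] -/
@[simp] theorem not_adj_inn_inn {w w' : Fin M} {S S' : Fin 2 → ZMod 2} : ¬ (mgraph R c).Adj (inn w S) (inn w' S') := by
  rw [madj_iff]; simp [mrel]
/-- No inner–link edges. [folklore] -/
@[simp] theorem not_adj_inn_lk {w : Fin M} {S : Fin 2 → ZMod 2} {δ : Dart M 3} {a : ZMod 2} :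
    ¬ (mgraph R c).Adj (inn w S) (lk δ a) := by rw [madj_iff]; simp [mrel]
/-- No link–inner edges. [folklore] -/
@[simp] theorem not_adj_lk_inn {w : Fin M} {S : Fin 2 → ZMod 2} {δ : Dart M 3} {a : ZMod 2} :
    ¬ (mgraph R c).Adj (lk δ a) (inn w S) := by rw [madj_iff]; simp [mrel]
/-- No balance–balance edges. [folklore] -/
@[simp] theorem not_adj_bal_bal {w w' : Fin M} : ¬ (mgraph R c).Adj (bal w) (bal w' : MVert M) := by
  rw [madj_iff]; simp [mrel]
/-- No balance–end edges. [folklore] -/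
@[simp] theorem not_adj_bal_en {w : Fin M} {δ : Dart M 3} {a : ZMod 2} : ¬ (mgraph R c).Adj (bal w) (en δ a) := by
  rw [madj_iff]; simp [mrel]
/-- No end–balance edges. [folklore] -/
@[simp] theorem not_adj_en_bal {w : Fin M} {δ : Dart M 3} {a : ZMod 2} : ¬ (mgraph R c).Adj (en δ a) (bal w : MVert M) := by
  rw [madj_iff]; simp [mrel]
/-- No balance–link edges. [folklore] -/
@[simp] theorem not_adj_bal_lk {w : Fin M} {δ : Dart M 3} {a : ZMod 2} : ¬ (mgraph R c).Adj (bal w) (lk δ a) := by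
  rw [madj_iff]; simp [mrel]
/-- No link–balance edges. [folklore] -/
@[simp] theorem not_adj_lk_bal {w : Fin M} {δ : Dart M 3} {a : ZMod 2} : ¬ (mgraph R c).Adj (lk δ a) (bal w : MVert M) := by
  rw [madj_iff]; simp [mrel]
/-- No end–end edges. [folklore] -/
@[simp] theorem not_adj_en_en {δ δ' : Dart M 3} {a a' : ZMod 2} : ¬ (mgraph R c).Adj (en δ a) (en δ' a' : MVert M) := by
  rw [madj_iff]; simp [mrel]

/-! ### Canonical darts -/

variable (R)

/-- Exactly one of `δ`, `rot δ` is canonical, when there are no half-edges. [folklore] -/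
theorem canon_or_canon_rot (hR : NoFixed R) (δ : Dart M 3) : Canon R δ ∨ Canon R (R.rot δ) := by
  unfold Canon
  rw [R.rot_rot]
  rcases lt_trichotomy (code δ) (code (R.rot δ)) with h | h | h
  · exact Or.inl h
  · exact absurd (code_injective h).symm (hR δ)
  · exact Or.inr h

/-- Not both of `δ`, `rot δ` are canonical. [folklore] -/
theorem not_canon_rot_of_canon {δ : Dart M 3} (h : Canon R δ) : ¬ Canon R (R.rot δ) := by
  unfold Canon at *; rw [R.rot_rot]; exact lt_asymm h

/-- The canonical dart of the edge of `δ`. [folklore] -/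
def κ (δ : Dart M 3) : Dart M 3 := if Canon R δ then δ else R.rot δ

/-- `κ δ` is canonical (no half-edges). [folklore] -/
theorem canon_κ (hR : NoFixed R) (δ : Dart M 3) : Canon R (κ R δ) := by
  unfold κ; split_ifs with h
  · exact h
  · exact (canon_or_canon_rot R hR δ).resolve_left h

/-- `κ` is constant on edges. [folklore] -/
theorem κ_rot (hR : NoFixed R) (δ : Dart M 3) : κ R (R.rot δ) = κ R δ := by
  unfold κ
  by_cases h : Canon R δ
  · rw [if_neg (not_canon_rot_of_canon R h), if_pos h, R.rot_rot]
  · rw [if_pos ((canon_or_canon_rot R hR δ).resolve_left h), if_neg h]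

/-- `δ` is one of the two darts of the edge of `κ δ`. [folklore] -/
theorem self_eq_κ_or (δ : Dart M 3) : δ = κ R δ ∨ δ = R.rot (κ R δ) := by
  unfold κ; split_ifs
  · exact Or.inl rfl
  · exact Or.inr (R.rot_rot δ).symm

/-- The end vertex `(δ, a)` is adjacent to the link of its edge. [folklore] -/
theorem adj_en_lk_κ (hR : NoFixed R) (δ : Dart M 3) (a : ZMod 2) : (mgraph R c).Adj (en δ a) (lk (κ R δ) a) :=
  adj_en_lk.2 ⟨canon_κ R hR δ, rfl, self_eq_κ_or R δ⟩

/-- The only link adjacent to the end `(δ, a)` is `lk (κ δ) a`. [folklore] -/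
theorem eq_κ_of_adj_en_lk (hR : NoFixed R) {δ δ' : Dart M 3} {a a' : ZMod 2} (h : (mgraph R c).Adj (en δ a) (lk δ' a')) :
    δ' = κ R δ ∧ a' = a := by
  rw [adj_en_lk] at h
  obtain ⟨hc, rfl, hδ⟩ := h
  refine ⟨?_, rfl⟩
  rcases hδ with rfl | rfl
  · unfold κ; rw [if_pos hc]
  · rw [κ_rot R hR]; unfold κ; rw [if_pos hc]

/-! ### Perfect matchings as adjacent involutions -/

variable (c)

/-- The perfect matchings of `M(R, c)`, as partner maps: fixed-point-free adjacent involutions.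
[cite: DawarWilsenach2025, §7.2 (perfect matchings of X(Γ))] -/
abbrev PMI : Type := {τ : Equiv.Perm (MVert M) // ∀ v, (mgraph R c).Adj v (τ v) ∧ τ (τ v) = v}

/-- `PMI` is finite. [folklore] -/
instance PMI.fintype : Fintype (PMI R c) := Subtype.fintype _

variable {R c}

namespace PMI

variable (τ : PMI R c)

/-- The partner is adjacent. [folklore] -/
theorem adj (v : MVert M) : (mgraph R c).Adj v (τ.1 v) := (τ.2 v).1

/-- The partner map is an involution. [folklore] -/
theorem inv (v : MVert M) : τ.1 (τ.1 v) = v := (τ.2 v).2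

/-- If `τ v = w` then `τ w = v`. [folklore] -/
theorem symm_apply {v w : MVert M} (h : τ.1 v = w) : τ.1 w = v := by rw [← h, τ.inv]

/-- The partner of a balance vertex is an inner vertex of the same base vertex. [folklore] -/
theorem bal_partner (w : Fin M) : ∃ S, τ.1 (bal w) = inn w S := by
  have h := τ.adj (bal w)
  generalize hy : τ.1 (bal w) = y at h
  rcases y with ⟨w', S⟩ | w' | ⟨δ, a⟩ | ⟨δ, a⟩
  · rw [adj_bal_inn] at h; subst h; exact ⟨S, rfl⟩
  · exact absurd h not_adj_bal_bal
  · exact absurd h not_adj_bal_en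
  · exact absurd h not_adj_bal_lk

/-- The partner of a non-canonical link vertex is its twin. [folklore] -/
theorem lk_partner_of_not_canon {δ : Dart M 3} (hδ : ¬ Canon R δ) (a : ZMod 2) : τ.1 (lk δ a) = lk δ (a + 1) := by
  have h := τ.adj (lk δ a)
  generalize hy : τ.1 (lk δ a) = y at h
  rcases y with ⟨w', S⟩ | w' | ⟨δ', a'⟩ | ⟨δ', a'⟩
  · exact absurd h not_adj_lk_inn
  · exact absurd h not_adj_lk_bal
  · rw [adj_lk_en] at h; exact absurd h.1 hδ
  · rw [adj_lk_lk] at h; obtain ⟨-, rfl, rfl⟩ := h; rfl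

/-- The partner of a canonical link vertex is one of the two ends of its edge. [folklore] -/
theorem lk_partner_of_canon {δ : Dart M 3} (hδ : Canon R δ) (a : ZMod 2) :
    τ.1 (lk δ a) = en δ a ∨ τ.1 (lk δ a) = en (R.rot δ) a := by
  have h := τ.adj (lk δ a)
  generalize hy : τ.1 (lk δ a) = y at h
  rcases y with ⟨w', S⟩ | w' | ⟨δ', a'⟩ | ⟨δ', a'⟩
  · exact absurd h not_adj_lk_inn
  · exact absurd h not_adj_lk_bal
  · rw [adj_lk_en] at h; obtain ⟨-, rfl, rfl | rfl⟩ := h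
    · exact Or.inl rfl
    · exact Or.inr rfl
  · rw [adj_lk_lk] at h; exact absurd hδ h.1

/-- **Inward ends**: the end `(δ, a)` is matched into its gadget. [cite: DawarWilsenach2025, §7.2 (the projection p_M(v, e))] -/
def Inward (δ : Dart M 3) (a : ZMod 2) : Prop := ∃ S, τ.1 (en δ a) = inn δ.1 S

/-- The partner of an end is an inner vertex of its gadget (inward) or the link of its edge. [folklore] -/
theorem en_partner (hR : NoFixed R) (δ : Dart M 3) (a : ZMod 2) :
    (∃ S, τ.1 (en δ a) = inn δ.1 S ∧ bit (c δ.1) S δ.2 = a) ∨ τ.1 (en δ a) = lk (κ R δ) a := by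
  have h := τ.adj (en δ a)
  generalize hy : τ.1 (en δ a) = y at h
  rcases y with ⟨w', S⟩ | w' | ⟨δ', a'⟩ | ⟨δ', a'⟩
  · rw [adj_en_inn] at h; obtain ⟨rfl, hb⟩ := h; exact Or.inl ⟨S, rfl, hb⟩
  · exact absurd h not_adj_en_bal
  · exact absurd h not_adj_en_en
  · obtain ⟨rfl, rfl⟩ := eq_κ_of_adj_en_lk R hR (hy ▸ τ.adj (en δ a)); exact Or.inr rfl

/-- Not inward means matched to the link. [folklore] -/
theorem not_inward_iff (hR : NoFixed R) (δ : Dart M 3) (a : ZMod 2) : ¬ τ.Inward δ a ↔ τ.1 (en δ a) = lk (κ R δ) a := by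
  constructor
  · intro h
    rcases τ.en_partner hR δ a with ⟨S, hS, -⟩ | h'
    · exact absurd ⟨S, hS⟩ h
    · exact h'
  · rintro h ⟨S, hS⟩
    rw [h] at hS; exact Sum.inr_ne_inl hS

/-- The link of the edge of `δ` is matched to `(δ, a)` or to `(rot δ, a)`. [folklore] -/
theorem lk_κ_partner (hR : NoFixed R) (δ : Dart M 3) (a : ZMod 2) :
    τ.1 (lk (κ R δ) a) = en δ a ∨ τ.1 (lk (κ R δ) a) = en (R.rot δ) a := by
  have h := τ.lk_partner_of_canon (canon_κ R hR δ) a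
  unfold κ at h ⊢
  split_ifs at h ⊢ with hc
  · exact h
  · rw [R.rot_rot] at h; exact h.symm

/-- **Exactly one of the two ends `(δ, a)`, `(rot δ, a)` of an edge is inward** (the link takes
the other). [cite: DawarWilsenach2025, §7.2 ("p_M(u,e) + p_M(v,e) = 2")] -/
theorem inward_iff_not_inward_rot (hR : NoFixed R) (δ : Dart M 3) (a : ZMod 2) :
    τ.Inward δ a ↔ ¬ τ.Inward (R.rot δ) a := by
  have hne : en δ a ≠ (en (R.rot δ) a : MVert M) := by
    intro h
    have := Sum.inl.inj (Sum.inr.inj (Sum.inr.inj h))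
    exact hR δ ((Prod.ext_iff.1 this).1).symm
  rw [τ.not_inward_iff hR, κ_rot R hR, ← not_iff_not, τ.not_inward_iff hR]
  -- `τ (en δ a) = L ↔ ¬ τ (en (rot δ) a) = L` for the link `L` of the edge
  constructor
  · intro h h'
    rw [← h'] at h
    exact hne (τ.1.injective h)
  · intro h'
    rcases τ.lk_κ_partner hR δ a with h | h
    · exact τ.symm_apply h
    · exact absurd (τ.symm_apply h) h'

/-- An inner vertex is matched to the balance vertex or to an (inward) end of its gadget. [folklore] -/
theorem inn_partner (w : Fin M) (S : Fin 2 → ZMod 2) :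
    τ.1 (inn w S) = bal w ∨ ∃ j, τ.1 (inn w S) = en (w, j) (bit (c w) S j) := by
  have h := τ.adj (inn w S)
  generalize hy : τ.1 (inn w S) = y at h
  rcases y with ⟨w', S'⟩ | w' | ⟨⟨w', j⟩, a⟩ | ⟨δ', a'⟩
  · exact absurd h not_adj_inn_inn
  · rw [adj_inn_bal] at h; subst h; exact Or.inl rfl
  · rw [adj_inn_en] at h; obtain ⟨rfl, rfl⟩ := h; exact Or.inr ⟨j, rfl⟩
  · exact absurd h not_adj_inn_lk

/-- **Three inward ends per gadget**: the inward pairs `(j, a)` at `w` are the images of the three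
inner vertices not matched to the balance vertex. [cite: DawarWilsenach2025, §7.2 ("p_M(v,f) + p_M(v,g) + p_M(v,h) = 3")] -/
theorem card_inward (w : Fin M) :
    ((univ : Finset (Fin 3 × ZMod 2)).filter fun ja => τ.Inward (w, ja.1) ja.2).card = 3 := by
  obtain ⟨S₀, hS₀⟩ := τ.bal_partner w
  -- the inner vertices other than `S₀` biject with the inward pairs
  have hS₀' : τ.1 (inn w S₀) = bal w := τ.symm_apply hS₀
  have hex : ∀ S, S ≠ S₀ → ∃ j, τ.1 (inn w S) = en (w, j) (bit (c w) S j) := by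
    intro S hS
    refine (τ.inn_partner w S).resolve_left fun h => hS ?_
    have : inn w S = τ.1 (bal w) := by rw [← h, τ.inv]
    rw [hS₀] at this
    exact (Prod.ext_iff.1 (Sum.inl.inj this)).2
  have key : ((univ : Finset (Fin 2 → ZMod 2)).filter fun S => S ≠ S₀).card =
      ((univ : Finset (Fin 3 × ZMod 2)).filter fun ja => τ.Inward (w, ja.1) ja.2).card := by
    refine Finset.card_bij' (fun S hS => ((hex S (Finset.mem_filter.1 hS).2).choose,
        bit (c w) S (hex S (Finset.mem_filter.1 hS).2).choose))
      (fun ja hja => ((Finset.mem_filter.1 hja).2 : τ.Inward (w, ja.1) ja.2).choose)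
      (fun S hS => ?_) (fun ja hja => ?_) (fun S hS => ?_) (fun ja hja => ?_)
    · -- into the inward pairs
      have h := (hex S (Finset.mem_filter.1 hS).2).choose_spec
      exact Finset.mem_filter.2 ⟨mem_univ _, S, τ.symm_apply h⟩
    · -- back: the chosen inner vertex is not `S₀`
      have h := ((Finset.mem_filter.1 hja).2 : τ.Inward (w, ja.1) ja.2).choose_spec
      refine Finset.mem_filter.2 ⟨mem_univ _, fun heq => ?_⟩
      rw [heq] at h
      have := τ.symm_apply h
      rw [hS₀'] at this
      exact Sum.inl_ne_inr (Sum.inr.inj this)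
    · -- left inverse
      have hj := (hex S (Finset.mem_filter.1 hS).2).choose_spec
      have hin : τ.Inward (w, (hex S (Finset.mem_filter.1 hS).2).choose)
          (bit (c w) S (hex S (Finset.mem_filter.1 hS).2).choose) := ⟨S, τ.symm_apply hj⟩
      show hin.choose = S
      have h1 := hin.choose_spec
      have h2 := τ.symm_apply hj
      rw [h1] at h2
      exact (Prod.ext_iff.1 (Sum.inl.inj h2)).2
    · -- right inverse
      have hin : τ.Inward (w, ja.1) ja.2 := (Finset.mem_filter.1 hja).2
      have h1 : τ.1 (en (w, ja.1) ja.2) = inn w hin.choose := hin.choose_spec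
      have hne : hin.choose ≠ S₀ := by
        intro heq
        have := τ.symm_apply h1
        rw [heq, hS₀'] at this
        exact Sum.inl_ne_inr (Sum.inr.inj this)
      have hj := (hex hin.choose hne).choose_spec
      have h2 := τ.symm_apply h1
      rw [hj] at h2
      have h3 := Prod.ext_iff.1 (Sum.inl.inj (Sum.inr.inj (Sum.inr.inj h2)))
      simp only [Prod.mk.injEq, true_and] at h3
      show ((hex hin.choose hne).choose, bit (c w) hin.choose (hex hin.choose hne).choose) = ja
      exact Prod.ext h3.1 h3.2
  rw [← key, Finset.filter_ne', Finset.card_erase_of_mem (mem_univ _), Finset.card_univ]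
  simp [ZMod.card]

end PMI


namespace PMI

variable (τ : PMI R c)

/-- **The projection** `p(δ) ∈ {0, 1, 2}`: the number of inward ends of the dart `δ`.
[cite: DawarWilsenach2025, §7.2 (Non-Uniform Matchings: "the projection p_M(v, e)")] -/
def proj (δ : Dart M 3) : ℕ := ((univ : Finset (ZMod 2)).filter fun a => τ.Inward δ a).card

/-- `p(δ) ≤ 2`. [folklore] -/
theorem proj_le_two (δ : Dart M 3) : τ.proj δ ≤ 2 :=
  (Finset.card_filter_le _ _).trans (by rw [Finset.card_univ, ZMod.card])

/-- **`p(δ) + p(rot δ) = 2`.** [cite: DawarWilsenach2025, §7.2 ("p_M(u,e) + p_M(v,e) = 2 for each edge")] -/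
theorem proj_add_proj_rot (hR : NoFixed R) (δ : Dart M 3) : τ.proj δ + τ.proj (R.rot δ) = 2 := by
  unfold proj
  have : ((univ : Finset (ZMod 2)).filter fun a => τ.Inward (R.rot δ) a) =
      (univ : Finset (ZMod 2)).filter fun a => ¬ τ.Inward δ a :=
    Finset.filter_congr fun a _ => by rw [τ.inward_iff_not_inward_rot hR, R.rot_rot]
  rw [this, Finset.card_filter_add_card_filter_not, Finset.card_univ, ZMod.card]

/-- **`∑_j p(w, j) = 3`.** [cite: DawarWilsenach2025, §7.2 ("p_M(v,f) + p_M(v,g) + p_M(v,h) = 3 for each vertex")] -/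
theorem sum_proj (w : Fin M) : ∑ j : Fin 3, τ.proj (w, j) = 3 := by
  have h := τ.card_inward w
  rw [Finset.card_filter, Fintype.sum_prod_type] at h
  refine Eq.trans ?_ h
  refine Finset.sum_congr rfl fun j _ => ?_
  rw [proj, Finset.card_filter]

/-- UNIFORM matchings: every projection is `1`. [cite: DawarWilsenach2025, §7.2 ("M is uniform if p_M(v,e) = 1 everywhere")] -/
def IsUniform (τ : PMI R c) : Prop := ∀ δ, τ.proj δ = 1

/-- **A non-uniform matching has a dart with projection `2`.** [cite: DawarWilsenach2025, Lemma 7.5 (proof: "for some edge e = {u,v}, p(u,e) = 2 and p(v,e) = 0")] -/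
theorem exists_proj_eq_two (hR : NoFixed R) (h : ¬ τ.IsUniform) : ∃ δ, τ.proj δ = 2 := by
  unfold IsUniform at h
  push Not at h
  obtain ⟨δ, hδ⟩ := h
  have h2 := τ.proj_le_two δ
  have hs := τ.proj_add_proj_rot hR δ
  rcases Nat.lt_or_ge (τ.proj δ) 1 with h1 | h1
  · exact ⟨R.rot δ, by omega⟩
  · exact ⟨δ, by omega⟩

/-- Projection `2`: both ends inward. [folklore] -/
theorem inward_of_proj_eq_two {δ : Dart M 3} (h : τ.proj δ = 2) (a : ZMod 2) : τ.Inward δ a := by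
  unfold proj at h
  have : ((univ : Finset (ZMod 2)).filter fun a => τ.Inward δ a) = univ :=
    Finset.eq_univ_of_card _ (by rw [h, ZMod.card])
  have ha : a ∈ (univ : Finset (ZMod 2)).filter fun a => τ.Inward δ a := by rw [this]; exact mem_univ a
  exact (Finset.mem_filter.1 ha).2

end PMI

/-! ### Gauge transformations with a separate shift for the links -/

/-- The shift with the link vertices shifted by their own function `ℓ` (equal to `g` on all
edges where `g` is constant). [cite: DawarWilsenach2025, Lemma 7.5 (proof: the isomorphism X(Γ)⁻ ≅ X̃(Γ)⁻)] -/
def mshiftL (g ℓ : Dart M 3 → ZMod 2) : MVert M → MVert M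
  | .inl (w, S') => .inl (w, S' + fun i => g (w, Fin.castSucc i))
  | .inr (.inl w) => .inr (.inl w)
  | .inr (.inr (.inl (δ, a))) => .inr (.inr (.inl (δ, a + g δ)))
  | .inr (.inr (.inr (δ, a))) => .inr (.inr (.inr (δ, a + ℓ δ)))

/-- `mshiftL` is an involution. [folklore] -/
theorem mshiftL_mshiftL (g ℓ : Dart M 3 → ZMod 2) (x : MVert M) : mshiftL g ℓ (mshiftL g ℓ x) = x := by
  rcases x with ⟨w, S'⟩ | w | ⟨δ, a⟩ | ⟨δ, a⟩
  · simp only [mshiftL, Sum.inl.injEq, Prod.mk.injEq, true_and]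
    funext i; simp [add_assoc, zmod2_add_self]
  · rfl
  · simp [mshiftL, add_assoc, zmod2_add_self]
  · simp [mshiftL, add_assoc, zmod2_add_self]

/-- `mshiftL` as a permutation. [folklore] -/
def mshiftLE (g ℓ : Dart M 3 → ZMod 2) : Equiv.Perm (MVert M) :=
  Function.Involutive.toPerm (mshiftL g ℓ) (mshiftL_mshiftL g ℓ)

/-- `mshiftLE` acts by `mshiftL`. [folklore] -/
@[simp] theorem mshiftLE_apply (g ℓ : Dart M 3 → ZMod 2) (x : MVert M) : mshiftLE g ℓ x = mshiftL g ℓ x := rfl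

variable (R)

/-- The side condition under which `mshiftL g ℓ` preserves the adjacency of `x` and `y`: for a
link and an end of its edge, the end's `g` equals the link's `ℓ`. [folklore] -/
def LinkOK (g ℓ : Dart M 3 → ZMod 2) : MVert M → MVert M → Prop
  | .inr (.inr (.inr (δ, _))), .inr (.inr (.inl (δ', _))) => (δ' = δ ∨ δ' = R.rot δ) → g δ' = ℓ δ
  | .inr (.inr (.inl (δ', _))), .inr (.inr (.inr (δ, _))) => (δ' = δ ∨ δ' = R.rot δ) → g δ' = ℓ δ
  | _, _ => True

variable {R}

/-- **`mshiftL g ℓ` transports `mrel c` to `mrel (c + ∂g)` on pairs satisfying `LinkOK`.** [cite: DawarWilsenach2025, Lemma 7.5 (proof)] -/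
theorem mrel_shiftL_iff {g ℓ : Dart M 3 → ZMod 2} (c : Fin M → ZMod 2) {x y : MVert M} (hxy : LinkOK R g ℓ x y) :
    mrel R (c + bd g) (mshiftL g ℓ x) (mshiftL g ℓ y) ↔ mrel R c x y := by
  rcases x with ⟨w, S⟩ | w | ⟨δ, a⟩ | ⟨δ, a⟩ <;> rcases y with ⟨w', S'⟩ | w' | ⟨δ', a'⟩ | ⟨δ', a'⟩ <;>
    simp only [mshiftL, mrel, LinkOK] at hxy ⊢
  · constructor
    · rintro ⟨rfl, h⟩
      refine ⟨rfl, ?_⟩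
      rw [bit_shift] at h
      exact add_right_cancel h
    · rintro ⟨rfl, h⟩
      refine ⟨rfl, ?_⟩
      rw [bit_shift, h]
  · constructor
    · rintro ⟨hc, ha, hδ⟩
      refine ⟨hc, ?_, hδ⟩
      rw [hxy hδ] at ha
      exact add_right_cancel ha
    · rintro ⟨hc, rfl, hδ⟩
      exact ⟨hc, by rw [hxy hδ], hδ⟩
  · constructor
    · rintro ⟨hc, rfl, ha⟩
      refine ⟨hc, rfl, ?_⟩
      rw [add_right_comm] at ha
      exact add_right_cancel ha
    · rintro ⟨hc, rfl, rfl⟩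
      exact ⟨hc, rfl, add_right_comm _ _ _⟩

/-- **`mshiftL g ℓ` preserves adjacency (into `M(R, c + ∂g)`) on pairs satisfying `LinkOK` both
ways.** [cite: DawarWilsenach2025, Lemma 7.5 (proof)] -/
theorem madj_shiftL_iff {g ℓ : Dart M 3 → ZMod 2} (c : Fin M → ZMod 2) {x y : MVert M}
    (hxy : LinkOK R g ℓ x y) (hyx : LinkOK R g ℓ y x) :
    (mgraph R (c + bd g)).Adj (mshiftL g ℓ x) (mshiftL g ℓ y) ↔ (mgraph R c).Adj x y := by
  simp only [mgraph, SimpleGraph.fromRel_adj, ne_eq,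
    (Function.Involutive.injective (mshiftL_mshiftL g ℓ)).eq_iff, mrel_shiftL_iff c hxy, mrel_shiftL_iff c hyx]

/-! ### Conjugating a perfect matching by a gauge transformation -/

/-- Conjugation of the partner map by the involution `mshiftL g ℓ`. [cite: DawarWilsenach2025, Lemma 7.5 (proof)] -/
def conjMap (g ℓ : Dart M 3 → ZMod 2) (τ : Equiv.Perm (MVert M)) : Equiv.Perm (MVert M) :=
  ((mshiftLE g ℓ).trans τ).trans (mshiftLE g ℓ)

/-- `conjMap` applied. [folklore] -/
theorem conjMap_apply (g ℓ : Dart M 3 → ZMod 2) (τ : Equiv.Perm (MVert M)) (x : MVert M) :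
    conjMap g ℓ τ x = mshiftL g ℓ (τ (mshiftL g ℓ x)) := rfl

/-- Conjugating twice gives back the matching. [folklore] -/
theorem conjMap_conjMap (g ℓ : Dart M 3 → ZMod 2) (τ : Equiv.Perm (MVert M)) : conjMap g ℓ (conjMap g ℓ τ) = τ := by
  ext x
  simp only [conjMap_apply, mshiftL_mshiftL]

/-- **The conjugate of a perfect matching of `M(R, c)` all of whose pairs satisfy `LinkOK` is a
perfect matching of `M(R, c + ∂g)`.** [cite: DawarWilsenach2025, Lemma 7.5 (proof)] -/
theorem conjMap_mem {g ℓ : Dart M 3 → ZMod 2} (τ : PMI R c)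
    (hok : ∀ u, LinkOK R g ℓ u (τ.1 u) ∧ LinkOK R g ℓ (τ.1 u) u) :
    ∀ v, (mgraph R (c + bd g)).Adj v (conjMap g ℓ τ.1 v) ∧ conjMap g ℓ τ.1 (conjMap g ℓ τ.1 v) = v := by
  intro v
  refine ⟨?_, by rw [conjMap_apply, conjMap_apply, mshiftL_mshiftL, τ.inv, mshiftL_mshiftL]⟩
  rw [conjMap_apply]
  conv_lhs => rw [← mshiftL_mshiftL g ℓ v]
  rw [madj_shiftL_iff c (hok _).1 (hok _).2]
  exact τ.adj _

/-- The conjugate perfect matching. [cite: DawarWilsenach2025, Lemma 7.5 (proof)] -/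
def PMI.conj {g ℓ : Dart M 3 → ZMod 2} (τ : PMI R c)
    (hok : ∀ u, LinkOK R g ℓ u (τ.1 u) ∧ LinkOK R g ℓ (τ.1 u) u) : PMI R (c + bd g) :=
  ⟨conjMap g ℓ τ.1, conjMap_mem τ hok⟩

/-- **Inward ends of the conjugate**: `(δ, a)` is inward for the conjugate iff `(δ, a + g δ)` is
inward for `τ`. [folklore] -/
theorem PMI.inward_conj_iff {g ℓ : Dart M 3 → ZMod 2} (τ : PMI R c)
    (hok : ∀ u, LinkOK R g ℓ u (τ.1 u) ∧ LinkOK R g ℓ (τ.1 u) u) (δ : Dart M 3) (a : ZMod 2) :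
    (τ.conj hok).Inward δ a ↔ τ.Inward δ (a + g δ) := by
  unfold PMI.Inward
  show (∃ S, mshiftL g ℓ (τ.1 (mshiftL g ℓ (en δ a))) = inn δ.1 S) ↔ _
  have he : mshiftL g ℓ (en δ a) = en δ (a + g δ) := rfl
  rw [he]
  constructor
  · rintro ⟨S, hS⟩
    have := congrArg (mshiftL g ℓ) hS
    rw [mshiftL_mshiftL] at this
    exact ⟨_, this⟩
  · rintro ⟨S, hS⟩
    rw [hS]
    exact ⟨_, rfl⟩

/-- **Conjugation preserves projections.** [cite: DawarWilsenach2025, Lemma 7.5 (proof: "any matching M with p_M = p is also a perfect matching in X(Γ)⁻")] -/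
theorem PMI.proj_conj {g ℓ : Dart M 3 → ZMod 2} (τ : PMI R c)
    (hok : ∀ u, LinkOK R g ℓ u (τ.1 u) ∧ LinkOK R g ℓ (τ.1 u) u) (δ : Dart M 3) :
    (τ.conj hok).proj δ = τ.proj δ := by
  unfold PMI.proj
  refine Finset.card_bij (fun a _ => a + g δ) (fun a ha => ?_) (fun a _ b _ h => add_right_cancel h) (fun b hb => ?_)
  · rw [Finset.mem_filter] at ha ⊢
    exact ⟨mem_univ _, (τ.inward_conj_iff hok δ a).1 ha.2⟩
  · refine ⟨b + g δ, ?_, by rw [add_assoc, zmod2_add_self, add_zero]⟩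
    rw [Finset.mem_filter] at hb ⊢
    refine ⟨mem_univ _, (τ.inward_conj_iff hok δ _).2 ?_⟩
    rw [add_assoc, zmod2_add_self, add_zero]; exact hb.2

/-! ### Gauges along walks of the territory graph -/

section Gauge

variable (R)

/-- The indicator of a dart. [folklore] -/
def dind (δ₀ : Dart M 3) : Dart M 3 → ZMod 2 := fun δ => if δ = δ₀ then 1 else 0

/-- The boundary of a dart indicator is the indicator of its base vertex. [folklore] -/
theorem bd_dind (δ₀ : Dart M 3) : bd (dind δ₀) = Pi.single δ₀.1 1 := by
  funext w
  unfold bd dind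
  by_cases hw : w = δ₀.1
  · subst hw
    rw [Pi.single_eq_same]
    rw [Finset.sum_eq_single δ₀.2]
    · simp
    · intro j _ hj; rw [if_neg]; intro h; exact hj (by rw [← h])
    · intro h; exact absurd (mem_univ _) h
  · rw [Pi.single_eq_of_ne hw]
    refine Finset.sum_eq_zero fun j _ => ?_
    rw [if_neg]; intro h; exact hw (by rw [← h])

/-- `bd` is additive. [folklore] -/
theorem bd_add (f g : Dart M 3 → ZMod 2) : bd (f + g) = bd f + bd g := by
  funext w; simp [bd, Finset.sum_add_distrib]

/-- `bd 0 = 0`. [folklore] -/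
theorem bd_zero : bd (0 : Dart M 3 → ZMod 2) = 0 := by
  funext w; simp [bd]

/-- `Pi.single u 1 + Pi.single u 1 = 0` over `ZMod 2`. [folklore] -/
theorem single_add_single_self (u : Fin M) : (Pi.single u (1 : ZMod 2) : Fin M → ZMod 2) + Pi.single u 1 = 0 := by
  funext w
  by_cases h : w = u
  · subst h; simp [zmod2_add_self]
  · simp [Pi.single_eq_of_ne h]

variable {D : Finset (Dart M 3)}

/-- A dart realising a step of the territory graph: unblocked, with unblocked reverse. [folklore] -/
theorem exists_stepDart {u v : Fin M} (h : (terr R D).Adj u v) :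
    ∃ i : Fin 3, R.nbr u i = v ∧ ((u, i) : Dart M 3) ∉ D ∧ R.rot (u, i) ∉ D :=
  ((TseitinColouring.terr_adj_iff R).1 h).2

/-- The chosen dart of a step. [folklore] -/
def stepDart {u v : Fin M} (h : (terr R D).Adj u v) : Dart M 3 := (u, (exists_stepDart R h).choose)

/-- The chosen dart goes from `u` to `v`. [folklore] -/
theorem rot_stepDart_fst {u v : Fin M} (h : (terr R D).Adj u v) : (R.rot (stepDart R h)).1 = v :=
  (exists_stepDart R h).choose_spec.1

/-- The chosen dart is unblocked. [folklore] -/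
theorem stepDart_notMem {u v : Fin M} (h : (terr R D).Adj u v) : stepDart R h ∉ D :=
  (exists_stepDart R h).choose_spec.2.1

/-- The reverse of the chosen dart is unblocked. [folklore] -/
theorem rot_stepDart_notMem {u v : Fin M} (h : (terr R D).Adj u v) : R.rot (stepDart R h) ∉ D :=
  (exists_stepDart R h).choose_spec.2.2

/-- **The gauge along a walk**: the sum of the indicators of the darts of its steps and their
reverses. [cite: DawarWilsenach2025, Lemma 7.3 (proof: "interchanging e₀ and e₁ for all edges on this path")] -/
def wgauge : ∀ {u v : Fin M}, (terr R D).Walk u v → (Dart M 3 → ZMod 2)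
  | _, _, .nil => 0
  | _, _, .cons h W => dind (stepDart R h) + dind (R.rot (stepDart R h)) + wgauge W

/-- The gauge along a walk is constant on edges. [folklore] -/
theorem wgauge_rot {u v : Fin M} (W : (terr R D).Walk u v) (δ : Dart M 3) : wgauge R W (R.rot δ) = wgauge R W δ := by
  induction W with
  | nil => rfl
  | cons h W ih =>
    simp only [wgauge, Pi.add_apply, ih]
    congr 1
    unfold dind
    have h1 : (R.rot δ = stepDart R h) ↔ (δ = R.rot (stepDart R h)) := by
      constructor
      · intro h'; rw [← h', R.rot_rot]
      · intro h'; rw [h', R.rot_rot]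
    have h2 : (R.rot δ = R.rot (stepDart R h)) ↔ (δ = stepDart R h) := by
      constructor
      · intro h'; have := congrArg R.rot h'; rwa [R.rot_rot, R.rot_rot] at this
      · intro h'; rw [h']
    rw [if_congr h1 rfl rfl, if_congr h2 rfl rfl, add_comm]

/-- The gauge along a walk vanishes on the blocked darts. [folklore] -/
theorem wgauge_eq_zero_of_mem {u v : Fin M} (W : (terr R D).Walk u v) {δ : Dart M 3}
    (hδ : δ ∈ D) : wgauge R W δ = 0 := by
  induction W with
  | nil => rfl
  | cons h W ih =>
    simp only [wgauge, Pi.add_apply, ih, add_zero]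
    unfold dind
    rw [if_neg, if_neg, add_zero]
    · intro h'; rw [h'] at hδ; exact rot_stepDart_notMem R h hδ
    · intro h'; rw [h'] at hδ; exact stepDart_notMem R h hδ

/-- **The boundary of the gauge along a walk from `u` to `v` is `1_u + 1_v`.** [cite: DawarWilsenach2025, Lemma 7.7 (proof: "reversing the direction of every edge on this path")] -/
theorem bd_wgauge {u v : Fin M} (W : (terr R D).Walk u v) : bd (wgauge R W) = Pi.single u 1 + Pi.single v 1 := by
  induction W with
  | nil => rw [wgauge, bd_zero, single_add_single_self]
  | @cons u u' v h W ih =>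
    rw [wgauge, bd_add, bd_add, ih, bd_dind, bd_dind, rot_stepDart_fst R h]
    show (Pi.single u 1 + Pi.single u' 1 + (Pi.single u' 1 + Pi.single v 1) : Fin M → ZMod 2) = _
    rw [add_assoc, ← add_assoc (Pi.single u' 1), single_add_single_self, zero_add]

end Gauge

/-! ### Lemma 7.5: non-uniform matchings of `M(R, c)` and `M(R, c + 1_x)` correspond -/

section NonUniform

variable (R)
variable (hT : TwoLeaving R) (x : Fin M)

/-- The chosen dart of projection `2` of a profile. [folklore] -/
def badDart (π : Dart M 3 → ℕ) (hπ : ∃ δ, π δ = 2) : Dart M 3 := hπ.choose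

/-- The chosen dart has projection `2`. [folklore] -/
theorem badDart_spec (π : Dart M 3 → ℕ) (hπ : ∃ δ, π δ = 2) : π (badDart π hπ) = 2 := hπ.choose_spec

/-- The blocked edge: the bad dart and its reverse. [folklore] -/
def badSet (π : Dart M 3 → ℕ) (hπ : ∃ δ, π δ = 2) : Finset (Dart M 3) := {badDart π hπ, R.rot (badDart π hπ)}

include hT in
/-- A walk from the base of the bad dart to `x` avoiding the bad edge (2-dart-connectivity).
[cite: DawarWilsenach2025, Lemma 7.5 (proof: "Since Γ is 2-connected, there is a path … that does not involve the edge e")] -/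
theorem nonempty_badWalk (π : Dart M 3 → ℕ) (hπ : ∃ δ, π δ = 2) :
    Nonempty ((terr R (badSet R π hπ)).Walk (badDart π hπ).1 x) :=
  reachable_of_twoLeaving R hT _ _ _

/-- The chosen walk. [folklore] -/
def badWalk (π : Dart M 3 → ℕ) (hπ : ∃ δ, π δ = 2) : (terr R (badSet R π hπ)).Walk (badDart π hπ).1 x :=
  (nonempty_badWalk R hT x π hπ).some

/-- **The twisting gauge**: the gauge along the walk plus the indicator of the bad dart (so that it
is NOT constant on the bad edge). [cite: DawarWilsenach2025, Lemma 7.5 (proof: "mapping e₀ to e₁ … and extending this using the induced automorphisms")] -/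
def gOf (π : Dart M 3 → ℕ) (hπ : ∃ δ, π δ = 2) : Dart M 3 → ZMod 2 :=
  wgauge R (badWalk R hT x π hπ) + dind (badDart π hπ)

/-- The link shift: the gauge along the walk only. [folklore] -/
def ℓOf (π : Dart M 3 → ℕ) (hπ : ∃ δ, π δ = 2) : Dart M 3 → ZMod 2 := wgauge R (badWalk R hT x π hπ)

/-- **The boundary of the twisting gauge is `1_x`.** [cite: DawarWilsenach2025, Lemma 7.5 (proof)] -/
theorem bd_gOf (π : Dart M 3 → ℕ) (hπ : ∃ δ, π δ = 2) : bd (gOf R hT x π hπ) = Pi.single x 1 := by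
  rw [gOf, bd_add, bd_wgauge, bd_dind, add_comm (Pi.single _ 1) (Pi.single x 1), add_assoc,
    single_add_single_self, add_zero]

/-- The data only depend on the profile. [folklore] -/
theorem gOf_congr {π π' : Dart M 3 → ℕ} (h : π = π') (hπ : ∃ δ, π δ = 2) (hπ' : ∃ δ, π' δ = 2) :
    gOf R hT x π hπ = gOf R hT x π' hπ' ∧ ℓOf R hT x π hπ = ℓOf R hT x π' hπ' := by
  subst h; exact ⟨rfl, rfl⟩

variable {R}

/-- **All pairs of a perfect matching with the profile `π` satisfy the link condition for the
twisting gauge**: the only edge on which `g` is not constant is the bad edge, both of whose ends at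
the bad dart are inward, so its links are matched to the other ends. [cite: DawarWilsenach2025, Lemma 7.5 (proof)] -/
theorem linkOK_of_proj (τ : PMI R c) (hπ : ∃ δ, τ.proj δ = 2) (u : MVert M) :
    LinkOK R (gOf R hT x τ.proj hπ) (ℓOf R hT x τ.proj hπ) u (τ.1 u) ∧
      LinkOK R (gOf R hT x τ.proj hπ) (ℓOf R hT x τ.proj hπ) (τ.1 u) u := by
  have hin : ∀ a, τ.Inward (badDart τ.proj hπ) a := τ.inward_of_proj_eq_two (badDart_spec τ.proj hπ)
  -- the key computation: for a link/end pair of `τ`, the end is not at the bad dart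
  have key : ∀ (δ δ' : Dart M 3) (a a' : ZMod 2), (τ.1 (lk δ a) = en δ' a' ∨ τ.1 (en δ' a') = lk δ a) →
      (δ' = δ ∨ δ' = R.rot δ) → gOf R hT x τ.proj hπ δ' = ℓOf R hT x τ.proj hπ δ := by
    intro δ δ' a a' hpair hδ'
    have hne : δ' ≠ badDart τ.proj hπ := by
      rintro rfl
      have h' : τ.1 (en (badDart τ.proj hπ) a') = lk δ a := by
        rcases hpair with h | h
        · exact τ.symm_apply h
        · exact h
      obtain ⟨S, hS⟩ := hin a'
      rw [hS] at h'
      exact Sum.inl_ne_inr h'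
    simp only [gOf, ℓOf, Pi.add_apply, dind, if_neg hne, add_zero]
    rcases hδ' with rfl | rfl
    · rfl
    · exact wgauge_rot R _ _
  constructor
  · generalize hv : τ.1 u = v
    rcases u with ⟨w, S⟩ | w | ⟨δ', a'⟩ | ⟨δ, a⟩ <;> rcases v with ⟨w1, S1⟩ | w1 | ⟨δ1, a1⟩ | ⟨δ2, a2⟩ <;>
      simp only [LinkOK] <;> try trivial
    · exact fun h => key _ _ _ _ (Or.inr hv) h
    · exact fun h => key _ _ _ _ (Or.inl hv) h
  · generalize hv : τ.1 u = v
    rcases u with ⟨w, S⟩ | w | ⟨δ', a'⟩ | ⟨δ, a⟩ <;> rcases v with ⟨w1, S1⟩ | w1 | ⟨δ1, a1⟩ | ⟨δ2, a2⟩ <;>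
      simp only [LinkOK] <;> try trivial
    · exact fun h => key _ _ _ _ (Or.inr hv) h
    · exact fun h => key _ _ _ _ (Or.inl hv) h

/-- Membership of the conjugate in `PMI` for a charge EQUAL to `c + ∂g`. [folklore] -/
theorem conjMap_mem_of_eq {g ℓ : Dart M 3 → ZMod 2} (τ : PMI R c)
    (hok : ∀ u, LinkOK R g ℓ u (τ.1 u) ∧ LinkOK R g ℓ (τ.1 u) u) {c' : Fin M → ZMod 2} (hc' : c' = c + bd g) :
    ∀ v, (mgraph R c').Adj v (conjMap g ℓ τ.1 v) ∧ conjMap g ℓ τ.1 (conjMap g ℓ τ.1 v) = v := by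
  subst hc'; exact conjMap_mem τ hok

variable (hR : NoFixed R)

/-- **The twist of a non-uniform perfect matching of `M(R, c)`: a perfect matching of
`M(R, c + 1_x)`.** [cite: DawarWilsenach2025, Lemma 7.5] -/
def twist (τ : PMI R c) (hτ : ¬ τ.IsUniform) {c' : Fin M → ZMod 2} (hc' : c' = c + Pi.single x 1) : PMI R c' :=
  ⟨conjMap (gOf R hT x τ.proj (τ.exists_proj_eq_two hR hτ)) (ℓOf R hT x τ.proj (τ.exists_proj_eq_two hR hτ)) τ.1,
    conjMap_mem_of_eq τ (linkOK_of_proj hT x τ _) (by rw [bd_gOf]; exact hc')⟩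

/-- The twist has the same projections. [cite: DawarWilsenach2025, Lemma 7.5 (proof)] -/
theorem proj_twist (τ : PMI R c) (hτ : ¬ τ.IsUniform) {c' : Fin M → ZMod 2} (hc' : c' = c + Pi.single x 1) :
    (twist hT x hR τ hτ hc').proj = τ.proj := by
  have hg : c + bd (gOf R hT x τ.proj (τ.exists_proj_eq_two hR hτ)) = c' := by rw [bd_gOf]; exact hc'.symm
  subst hg
  funext δ
  exact τ.proj_conj (linkOK_of_proj hT x τ _) δ

/-- The twist is non-uniform. [folklore] -/
theorem not_uniform_twist (τ : PMI R c) (hτ : ¬ τ.IsUniform) {c' : Fin M → ZMod 2} (hc' : c' = c + Pi.single x 1) :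
    ¬ (twist hT x hR τ hτ hc').IsUniform := by
  intro h
  have h2 := badDart_spec τ.proj (τ.exists_proj_eq_two hR hτ)
  have h1 := h (badDart τ.proj (τ.exists_proj_eq_two hR hτ))
  rw [proj_twist] at h1
  omega

/-- **Twisting twice is the identity.** [folklore] -/
theorem twist_twist (τ : PMI R c) (hτ : ¬ τ.IsUniform) {c' : Fin M → ZMod 2} (hc' : c' = c + Pi.single x 1)
    (hc : c = c' + Pi.single x 1) :
    twist hT x hR (twist hT x hR τ hτ hc') (not_uniform_twist hT x hR τ hτ hc') hc = τ := by
  apply Subtype.ext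
  show conjMap _ _ (conjMap _ _ τ.1) = τ.1
  obtain ⟨hg, hl⟩ := gOf_congr R hT x (proj_twist hT x hR τ hτ hc')
    ((twist hT x hR τ hτ hc').exists_proj_eq_two hR (not_uniform_twist hT x hR τ hτ hc'))
    (τ.exists_proj_eq_two hR hτ)
  rw [hg, hl, conjMap_conjMap]

include hR hT in
/-- **Lemma 7.5 (Dawar–Wilsenach): `M(R, c)` and `M(R, c + 1_x)` have the same number of
non-uniform perfect matchings.** [cite: DawarWilsenach2025, Lemma 7.5] -/
theorem card_nonuniform_eq {c' : Fin M → ZMod 2} (hc' : c' = c + Pi.single x 1) :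
    Fintype.card {τ : PMI R c // ¬ τ.IsUniform} = Fintype.card {τ : PMI R c' // ¬ τ.IsUniform} := by
  have hc : c = c' + Pi.single x 1 := by rw [hc', add_assoc, single_add_single_self, add_zero]
  exact Fintype.card_congr
    { toFun := fun τ => ⟨twist hT x hR τ.1 τ.2 hc', not_uniform_twist hT x hR τ.1 τ.2 hc'⟩
      invFun := fun τ => ⟨twist hT x hR τ.1 τ.2 hc, not_uniform_twist hT x hR τ.1 τ.2 hc⟩
      left_inv := fun τ => Subtype.ext (twist_twist hT x hR τ.1 τ.2 hc' hc)
      right_inv := fun τ => Subtype.ext (twist_twist hT x hR τ.1 τ.2 hc hc') }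

end NonUniform

/-! ### Uniform matchings: labellings and the local structure (pp. 22–24) -/

section Uniform

namespace PMI

variable (τ : PMI R c)

/-- **The labelling of a uniform matching**: the index `a` of the inward end of each dart
(for uniform `τ` exactly one end `(δ, a)` of every dart is inward). It is ANTI-SYMMETRIC on edges
(`lab (rot δ) = lab δ + 1`): an orientation of `Γ` ("any uniform perfect matching `M` of `X`
induces an orientation of `Γ`"). [cite: DawarWilsenach2025, §7.2 (Matchings in gadgets: the orientation →Γ_M)] -/
def lab (δ : Dart M 3) : ZMod 2 := if τ.Inward δ 1 then 1 else 0

/-- For a uniform matching, `(δ, a)` is inward iff `a` is the label of `δ`. [folklore] -/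
theorem inward_iff_lab (hu : τ.IsUniform) (δ : Dart M 3) (a : ZMod 2) : τ.Inward δ a ↔ τ.lab δ = a := by
  have h1 := hu δ
  unfold proj at h1
  obtain ⟨a₀, ha₀⟩ := Finset.card_eq_one.1 h1
  have hiff : ∀ b, τ.Inward δ b ↔ b = a₀ := fun b => by
    have : b ∈ ((univ : Finset (ZMod 2)).filter fun a => τ.Inward δ a) ↔ b ∈ ({a₀} : Finset (ZMod 2)) := by rw [ha₀]
    simpa using this
  have hlab : τ.lab δ = a₀ := by
    unfold lab
    rcases zmod2_eq_zero_or_one a₀ with rfl | rfl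
    · rw [if_neg]; rw [hiff]; decide
    · rw [if_pos]; rw [hiff]
  rw [hiff, hlab, eq_comm]

/-- **The labelling is anti-symmetric on edges.** [cite: DawarWilsenach2025, §7.2 (orientations)] -/
theorem lab_rot (hR : NoFixed R) (hu : τ.IsUniform) (δ : Dart M 3) : τ.lab (R.rot δ) = τ.lab δ + 1 := by
  have h := (τ.inward_iff_lab hu (R.rot δ) (τ.lab δ + 1)).1
  apply h
  rw [← not_not (a := τ.Inward (R.rot δ) (τ.lab δ + 1)), ← τ.inward_iff_not_inward_rot hR δ,
    τ.inward_iff_lab hu]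
  exact (fin2_add_one_ne (τ.lab δ)).symm

end PMI

/-- **The local matchings at a vertex**: injective assignments of the balance vertex (`none`) and
the three inward ends (`some j`, with label `t j`) to the four inner vertices, compatible with the
adjacencies (`bit cw S j = t j`). [cite: DawarWilsenach2025, §7.2 (Matchings in gadgets: the relevant subgraph at v)] -/
def LocF (cw : ZMod 2) (t : Fin 3 → ZMod 2) : Type :=
  {f : Option (Fin 3) → (Fin 2 → ZMod 2) // Function.Injective f ∧ ∀ j, bit cw (f (some j)) j = t j}

/-- `LocF` is finite. [folklore] -/
instance LocF.fintype (cw : ZMod 2) (t : Fin 3 → ZMod 2) : Fintype (LocF cw t) := by unfold LocF; infer_instance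

set_option maxRecDepth 4000 in
/-- **The local count: `4` perfect matchings if the parity of the labels is the charge (the
subgraph `S` of the paper), `2` otherwise (the subgraph `T`).** [cite: DawarWilsenach2025, §7.2 (p. 23: "S has exactly four perfect matchings … T has exactly two perfect matchings")] -/
theorem card_LocF_all : ∀ (cw : ZMod 2) (t : Fin 3 → ZMod 2),
    Fintype.card (LocF cw t) = if t 0 + t 1 + t 2 = cw then 4 else 2 := by
  decide

/-- The local count. [cite: DawarWilsenach2025, §7.2 (p. 23)] -/
theorem card_LocF (cw : ZMod 2) (t : Fin 3 → ZMod 2) :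
    Fintype.card (LocF cw t) = if t 0 + t 1 + t 2 = cw then 4 else 2 := card_LocF_all cw t

/-- The local count is positive. [folklore] -/
theorem card_LocF_pos (cw : ZMod 2) (t : Fin 3 → ZMod 2) : 0 < Fintype.card (LocF cw t) := by
  rw [card_LocF]; split_ifs <;> norm_num

/-- A local matching as a bijection. [folklore] -/
def LocF.equiv {cw : ZMod 2} {t : Fin 3 → ZMod 2} (f : LocF cw t) : Option (Fin 3) ≃ (Fin 2 → ZMod 2) :=
  Equiv.ofBijective f.1 ((Fintype.bijective_iff_injective_and_card _).2 ⟨f.2.1, by simp [ZMod.card]⟩)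

/-- The bijection acts by the local matching. [folklore] -/
@[simp] theorem LocF.equiv_apply {cw : ZMod 2} {t : Fin 3 → ZMod 2} (f : LocF cw t) (o : Option (Fin 3)) :
    f.equiv o = f.1 o := rfl

variable (R c)

/-- The uniform perfect matchings with labelling `L`. [folklore] -/
abbrev UL (L : Dart M 3 → ZMod 2) : Type := {τ : PMI R c // τ.IsUniform ∧ τ.lab = L}

/-- Local data: a local matching at every vertex, for the charges `c` and labels `L`. [folklore] -/
abbrev LocData (L : Dart M 3 → ZMod 2) : Type := ∀ w : Fin M, LocF (c w) (fun j => L (w, j))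

variable {R c}

/-- **The local data of a uniform matching**: at `w`, the inner partners of the balance vertex and
of the three inward ends. [cite: DawarWilsenach2025, §7.2 (Matchings in gadgets)] -/
def locOf {L : Dart M 3 → ZMod 2} (τ : UL R c L) : LocData c L := fun w =>
  ⟨fun o => match o with
    | none => (τ.1.bal_partner w).choose
    | some j => ((τ.1.inward_iff_lab τ.2.1 (w, j) (L (w, j))).2 (by rw [τ.2.2])).choose,
   by
    have hb := (τ.1.bal_partner w).choose_spec
    have hs : ∀ j, τ.1.1 (en (w, j) (L (w, j))) =
        inn w ((τ.1.inward_iff_lab τ.2.1 (w, j) (L (w, j))).2 (by rw [τ.2.2])).choose := fun j =>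
      ((τ.1.inward_iff_lab τ.2.1 (w, j) (L (w, j))).2 (by rw [τ.2.2])).choose_spec
    refine ⟨?_, fun j => ?_⟩
    · rintro (_ | j) (_ | j') h
      · rfl
      · exfalso
        have h1 := τ.1.symm_apply hb
        have h2 := τ.1.symm_apply (hs j')
        simp only at h
        rw [h, h2] at h1
        cases h1
      · exfalso
        have h1 := τ.1.symm_apply hb
        have h2 := τ.1.symm_apply (hs j)
        simp only at h
        rw [← h, h2] at h1
        cases h1
      · have h1 := τ.1.symm_apply (hs j)
        have h2 := τ.1.symm_apply (hs j')
        simp only at h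
        rw [h, h2] at h1
        have := Prod.ext_iff.1 (Sum.inl.inj (Sum.inr.inj (Sum.inr.inj h1)))
        simp only [Prod.mk.injEq, true_and] at this
        rw [this.1]
    · have := τ.1.adj (en (w, j) (L (w, j)))
      rw [hs j, adj_en_inn] at this
      exact this.2⟩


/-- In `ZMod 2`, `a ≠ b + 1` forces `b = a`. [folklore] -/
theorem zmod2_eq_of_ne_add_one {a b : ZMod 2} (h : a ≠ b + 1) : b = a := by revert a b; decide

variable (R)
variable (hR : NoFixed R) {L : Dart M 3 → ZMod 2} (hL : ∀ δ, L (R.rot δ) = L δ + 1)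

/-- **The perfect matching glued from local data**: inner vertices and the balance vertex by the
local matching, the end `(δ, L δ)` inward by the local matching, the other end to the link of its
edge, canonical links to the non-inward end of their edge, non-canonical links to their twins.
[cite: DawarWilsenach2025, §7.2 (p. 23: "we get a perfect matching M with →Γ_M = →Γ by independently choosing exactly one matching in each relevant subgraph")] -/
def glue (β : LocData c L) : MVert M → MVert M
  | .inl (w, S) =>
      match (β w).equiv.symm S with
      | none => bal w
      | some j => en (w, j) (L (w, j))
  | .inr (.inl w) => inn w ((β w).1 none)
  | .inr (.inr (.inl (δ, a))) => if a = L δ then inn δ.1 ((β δ.1).1 (some δ.2)) else lk (κ R δ) a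
  | .inr (.inr (.inr (δ, a))) => if Canon R δ then (if L δ = a then en (R.rot δ) a else en δ a) else lk δ (a + 1)

/-- `glue` on an inner vertex matched to the balance vertex. [folklore] -/
theorem glue_inn_none (β : LocData c L) {w : Fin M} {S : Fin 2 → ZMod 2} (h : (β w).equiv.symm S = none) :
    glue R β (inn w S) = bal w := by
  simp only [glue, h]

/-- `glue` on an inner vertex matched to an end. [folklore] -/
theorem glue_inn_some (β : LocData c L) {w : Fin M} {S : Fin 2 → ZMod 2} {j : Fin 3} (h : (β w).equiv.symm S = some j) :
    glue R β (inn w S) = en (w, j) (L (w, j)) := by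
  simp only [glue, h]

/-- `glue` on a balance vertex. [folklore] -/
theorem glue_bal (β : LocData c L) (w : Fin M) : glue R β (bal w) = inn w ((β w).1 none) := rfl

/-- `glue` on an inward end. [folklore] -/
theorem glue_en_in (β : LocData c L) {δ : Dart M 3} {a : ZMod 2} (h : a = L δ) :
    glue R β (en δ a) = inn δ.1 ((β δ.1).1 (some δ.2)) := by
  show (if a = L δ then _ else _) = _; rw [if_pos h]

/-- `glue` on an outward end. [folklore] -/
theorem glue_en_out (β : LocData c L) {δ : Dart M 3} {a : ZMod 2} (h : a ≠ L δ) :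
    glue R β (en δ a) = lk (κ R δ) a := by
  show (if a = L δ then _ else _) = _; rw [if_neg h]

/-- `glue` on a canonical link. [folklore] -/
theorem glue_lk_canon (β : LocData c L) {δ : Dart M 3} (hδ : Canon R δ) (a : ZMod 2) :
    glue R β (lk δ a) = if L δ = a then en (R.rot δ) a else en δ a := by
  show (if Canon R δ then _ else _) = _; rw [if_pos hδ]

/-- `glue` on a non-canonical link. [folklore] -/
theorem glue_lk_not_canon (β : LocData c L) {δ : Dart M 3} (hδ : ¬ Canon R δ) (a : ZMod 2) :
    glue R β (lk δ a) = lk δ (a + 1) := by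
  show (if Canon R δ then _ else _) = _; rw [if_neg hδ]

include hR hL in
/-- **`glue` is an involution.** [folklore] -/
theorem glue_glue (β : LocData c L) (v : MVert M) : glue R β (glue R β v) = v := by
  rcases v with ⟨w, S⟩ | w | ⟨δ, a⟩ | ⟨δ, a⟩
  · -- inner vertex
    cases h : (β w).equiv.symm S with
    | none =>
      rw [show (Sum.inl (w, S) : MVert M) = inn w S from rfl, glue_inn_none R β h, glue_bal]
      have : (β w).1 none = S := by
        rw [Equiv.symm_apply_eq] at h; exact h.symm
      rw [this]
    | some j =>
      rw [show (Sum.inl (w, S) : MVert M) = inn w S from rfl, glue_inn_some R β h, glue_en_in R β rfl]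
      have : (β w).1 (some j) = S := by
        rw [Equiv.symm_apply_eq] at h; exact h.symm
      show inn w ((β w).1 (some j)) = inn w S
      rw [this]
  · -- balance vertex
    rw [show (Sum.inr (Sum.inl w) : MVert M) = bal w from rfl, glue_bal]
    have h : (β w).equiv.symm ((β w).1 none) = none := by
      rw [Equiv.symm_apply_eq]; rfl
    rw [glue_inn_none R β h]
  · -- end vertex
    by_cases ha : a = L δ
    · rw [show (Sum.inr (Sum.inr (Sum.inl (δ, a))) : MVert M) = en δ a from rfl, glue_en_in R β ha]
      have h : (β δ.1).equiv.symm ((β δ.1).1 (some δ.2)) = some δ.2 := by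
        rw [Equiv.symm_apply_eq]; rfl
      rw [glue_inn_some R β h, ha]
    · rw [show (Sum.inr (Sum.inr (Sum.inl (δ, a))) : MVert M) = en δ a from rfl, glue_en_out R β ha,
        glue_lk_canon R β (canon_κ R hR δ)]
      rcases self_eq_κ_or R δ with hδ | hδ
      · rw [← hδ, if_neg (Ne.symm ha)]
      · have hLδ : L δ = L (κ R δ) + 1 := by rw [← hL]; exact congrArg L hδ
        have hLa : L (κ R δ) = a := zmod2_eq_of_ne_add_one (by rw [← hLδ]; exact ha)
        rw [if_pos hLa, ← hδ]
  · -- link vertex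
    by_cases hc : Canon R δ
    · rw [show (Sum.inr (Sum.inr (Sum.inr (δ, a))) : MVert M) = lk δ a from rfl, glue_lk_canon R β hc]
      by_cases hLa : L δ = a
      · rw [if_pos hLa, glue_en_out R β, κ_rot R hR]
        · show lk (κ R δ) a = lk δ a
          unfold κ; rw [if_pos hc]
        · rw [hL, ← hLa]; exact (fin2_add_one_ne _).symm
      · rw [if_neg hLa, glue_en_out R β (Ne.symm hLa)]
        show lk (κ R δ) a = lk δ a
        unfold κ; rw [if_pos hc]
    · rw [show (Sum.inr (Sum.inr (Sum.inr (δ, a))) : MVert M) = lk δ a from rfl, glue_lk_not_canon R β hc,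
        glue_lk_not_canon R β hc, add_assoc, zmod2_add_self, add_zero]

include hR in
/-- **`glue` is an adjacent map.** [folklore] -/
theorem adj_glue (β : LocData c L) (v : MVert M) : (mgraph R c).Adj v (glue R β v) := by
  rcases v with ⟨w, S⟩ | w | ⟨δ, a⟩ | ⟨δ, a⟩
  · cases h : (β w).equiv.symm S with
    | none =>
      rw [show (Sum.inl (w, S) : MVert M) = inn w S from rfl, glue_inn_none R β h, adj_inn_bal]
    | some j =>
      rw [show (Sum.inl (w, S) : MVert M) = inn w S from rfl, glue_inn_some R β h, adj_inn_en]
      refine ⟨rfl, ?_⟩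
      have : (β w).1 (some j) = S := by rw [Equiv.symm_apply_eq] at h; exact h.symm
      rw [← this]
      exact (β w).2.2 j
  · rw [show (Sum.inr (Sum.inl w) : MVert M) = bal w from rfl, glue_bal, adj_bal_inn]
  · by_cases ha : a = L δ
    · rw [show (Sum.inr (Sum.inr (Sum.inl (δ, a))) : MVert M) = en δ a from rfl, glue_en_in R β ha, adj_en_inn]
      exact ⟨rfl, by rw [ha]; exact (β δ.1).2.2 δ.2⟩
    · rw [show (Sum.inr (Sum.inr (Sum.inl (δ, a))) : MVert M) = en δ a from rfl, glue_en_out R β ha]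
      exact adj_en_lk_κ R hR δ a
  · by_cases hc : Canon R δ
    · rw [show (Sum.inr (Sum.inr (Sum.inr (δ, a))) : MVert M) = lk δ a from rfl, glue_lk_canon R β hc]
      split_ifs
      · exact adj_lk_en.2 ⟨hc, rfl, Or.inr rfl⟩
      · exact adj_lk_en.2 ⟨hc, rfl, Or.inl rfl⟩
    · rw [show (Sum.inr (Sum.inr (Sum.inr (δ, a))) : MVert M) = lk δ a from rfl, glue_lk_not_canon R β hc]
      exact adj_lk_lk.2 ⟨hc, rfl, rfl⟩

/-- **The perfect matching glued from local data.** [cite: DawarWilsenach2025, §7.2 (p. 23)] -/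
def gluePMI (β : LocData c L) : PMI R c :=
  ⟨Function.Involutive.toPerm (glue R β) (glue_glue R hR hL β), fun v => ⟨adj_glue R hR β v, glue_glue R hR hL β v⟩⟩

/-- The glued matching acts by `glue`. [folklore] -/
@[simp] theorem gluePMI_apply (β : LocData c L) (v : MVert M) : (gluePMI R hR hL β).1 v = glue R β v := rfl

/-- Inward ends of the glued matching are the ends `(δ, L δ)`. [folklore] -/
theorem inward_glue_iff (β : LocData c L) (δ : Dart M 3) (a : ZMod 2) : (gluePMI R hR hL β).Inward δ a ↔ a = L δ := by
  unfold PMI.Inward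
  simp only [gluePMI_apply]
  constructor
  · rintro ⟨S, hS⟩
    by_contra ha
    rw [glue_en_out R β ha] at hS
    cases hS
  · intro ha
    rw [glue_en_in R β ha]
    exact ⟨_, rfl⟩

/-- **The glued matching is uniform with labelling `L`.** [folklore] -/
theorem gluePMI_uniform_lab (β : LocData c L) : (gluePMI R hR hL β).IsUniform ∧ (gluePMI R hR hL β).lab = L := by
  have hproj : ∀ δ, (gluePMI R hR hL β).proj δ = 1 := fun δ => by
    unfold PMI.proj
    rw [Finset.card_eq_one]
    refine ⟨L δ, ?_⟩
    ext a
    simp [inward_glue_iff]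
  refine ⟨hproj, funext fun δ => ?_⟩
  unfold PMI.lab
  rw [inward_glue_iff]
  rcases zmod2_eq_zero_or_one (L δ) with h | h <;> rw [h]
  · rw [if_neg (by decide)]
  · rw [if_pos rfl]

/-- Backward map: local data to uniform matchings with labelling `L`. [folklore] -/
def ofLoc (β : LocData c L) : UL R c L := ⟨gluePMI R hR hL β, gluePMI_uniform_lab R hR hL β⟩

/-- **Round trip: the local data of the glued matching are the data.** [folklore] -/
theorem locOf_ofLoc (β : LocData c L) : locOf (ofLoc R hR hL β) = β := by
  funext w
  apply Subtype.ext
  funext o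
  rcases o with _ | j
  · -- balance partner
    have h := ((ofLoc R hR hL β).1.bal_partner w).choose_spec
    change (gluePMI R hR hL β).1 (bal w) = inn w _ at h
    rw [gluePMI_apply, glue_bal] at h
    exact ((Prod.ext_iff.1 (Sum.inl.inj h)).2).symm
  · have h := (((ofLoc R hR hL β).1.inward_iff_lab (ofLoc R hR hL β).2.1 (w, j) (L (w, j))).2
      (by rw [(ofLoc R hR hL β).2.2])).choose_spec
    change (gluePMI R hR hL β).1 (en (w, j) (L (w, j))) = inn w _ at h
    rw [gluePMI_apply, glue_en_in R β rfl] at h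
    exact ((Prod.ext_iff.1 (Sum.inl.inj h)).2).symm

/-- **Round trip: gluing the local data of `τ` gives back `τ`** (two involutions agreeing on
balance vertices and ends agree everywhere). [folklore] -/
theorem ofLoc_locOf (τ : UL R c L) : ofLoc R hR hL (locOf τ) = τ := by
  obtain ⟨τ, hu, hlab⟩ := τ
  apply Subtype.ext
  apply Subtype.ext
  -- first the balance vertices and the ends
  have hbal : ∀ w, glue R (locOf ⟨τ, hu, hlab⟩) (bal w) = τ.1 (bal w) := fun w => by
    rw [glue_bal]
    exact ((τ.bal_partner w).choose_spec).symm
  have hen : ∀ δ a, glue R (locOf ⟨τ, hu, hlab⟩) (en δ a) = τ.1 (en δ a) := fun δ a => by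
    by_cases ha : a = L δ
    · rw [glue_en_in R _ ha]
      obtain ⟨w, j⟩ := δ
      subst ha
      exact (((τ.inward_iff_lab hu (w, j) (L (w, j))).2 (by rw [hlab])).choose_spec).symm
    · rw [glue_en_out R _ ha]
      symm
      rw [← τ.not_inward_iff hR, τ.inward_iff_lab hu, hlab]
      exact Ne.symm ha
  ext v
  show glue R (locOf ⟨τ, hu, hlab⟩) v = τ.1 v
  rcases v with ⟨w, S⟩ | w | ⟨δ, a⟩ | ⟨δ, a⟩
  · -- an inner vertex: its `τ`-partner `y` is a balance vertex or an end, where the maps agree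
    have key : ∀ y, τ.1 (inn w S) = y → glue R (locOf ⟨τ, hu, hlab⟩) y = τ.1 y →
        glue R (locOf ⟨τ, hu, hlab⟩) (inn w S) = y := by
      intro y hy hgy
      have h1 : τ.1 y = inn w S := τ.symm_apply hy
      rw [h1] at hgy
      have := congrArg (glue R (locOf ⟨τ, hu, hlab⟩)) hgy
      rw [glue_glue R hR hL] at this
      exact this.symm
    rcases τ.inn_partner w S with hy | ⟨j, hy⟩
    · exact (key _ hy (hbal w)).trans hy.symm
    · exact (key _ hy (hen _ _)).trans hy.symm
  · exact hbal w
  · exact hen δ a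
  · by_cases hc : Canon R δ
    · have key : ∀ y, τ.1 (lk δ a) = y → glue R (locOf ⟨τ, hu, hlab⟩) y = τ.1 y →
          glue R (locOf ⟨τ, hu, hlab⟩) (lk δ a) = y := by
        intro y hy hgy
        have h1 : τ.1 y = lk δ a := τ.symm_apply hy
        rw [h1] at hgy
        have := congrArg (glue R (locOf ⟨τ, hu, hlab⟩)) hgy
        rw [glue_glue R hR hL] at this
        exact this.symm
      rcases τ.lk_partner_of_canon hc a with hy | hy
      · exact (key _ hy (hen _ _)).trans hy.symm
      · exact (key _ hy (hen _ _)).trans hy.symm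
    · rw [glue_lk_not_canon R _ hc, τ.lk_partner_of_not_canon hc]

include hR hL in
/-- **The uniform perfect matchings with labelling `L` correspond to the local data.** [cite: DawarWilsenach2025, §7.2 (p. 23–24)] -/
theorem card_UL : Fintype.card (UL R c L) = ∏ w, Fintype.card (LocF (c w) (fun j => L (w, j))) := by
  rw [← Fintype.card_pi]
  exact Fintype.card_congr
    { toFun := locOf
      invFun := ofLoc R hR hL
      left_inv := ofLoc_locOf R hR hL
      right_inv := locOf_ofLoc R hR hL }


end Uniform

/-! ### Symmetric dart functions, their boundaries, anti-symmetric labellings (Lemmas 7.6–7.8) -/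

section Sym

variable (R)

/-- SYMMETRIC dart functions (constant on edges): the edge space `𝔽₂^E`. [cite: DawarWilsenach2025, Lemma 7.8 (proof: "the additive group of 𝔽₂^E has a natural action on the orientations")] -/
abbrev Sym : Type := {g : Dart M 3 → ZMod 2 // ∀ δ, g (R.rot δ) = g δ}

/-- ANTI-SYMMETRIC dart functions: orientations. [cite: DawarWilsenach2025, §7.2 (Orientations)] -/
abbrev AntiSym : Type := {L : Dart M 3 → ZMod 2 // ∀ δ, L (R.rot δ) = L δ + 1}

/-- `Sym` is finite. [folklore] -/
instance Sym.fintype : Fintype (Sym R) := Subtype.fintype _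

/-- `AntiSym` is finite. [folklore] -/
instance AntiSym.fintype : Fintype (AntiSym R) := Subtype.fintype _

/-- The reference orientation: canonical darts get `1`. [folklore] -/
def L₀ : Dart M 3 → ZMod 2 := fun δ => if Canon R δ then 1 else 0

/-- The reference orientation is anti-symmetric (no half-edges). [folklore] -/
theorem L₀_rot (hR : NoFixed R) (δ : Dart M 3) : L₀ R (R.rot δ) = L₀ R δ + 1 := by
  unfold L₀
  by_cases h : Canon R δ
  · rw [if_neg (not_canon_rot_of_canon R h), if_pos h]; decide
  · rw [if_pos ((canon_or_canon_rot R hR δ).resolve_left h), if_neg h]; decide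

/-- **Orientations form a torsor over the edge space**: `L ↦ L + L₀`. [cite: DawarWilsenach2025, Lemma 7.8 (proof)] -/
def antiSymEquiv (hR : NoFixed R) : AntiSym R ≃ Sym R where
  toFun L := ⟨fun δ => L.1 δ + L₀ R δ, fun δ => by
    show L.1 (R.rot δ) + L₀ R (R.rot δ) = L.1 δ + L₀ R δ
    rw [L.2, L₀_rot R hR, add_add_add_comm, zmod2_add_self, add_zero]⟩
  invFun g := ⟨fun δ => g.1 δ + L₀ R δ, fun δ => by
    show g.1 (R.rot δ) + L₀ R (R.rot δ) = g.1 δ + L₀ R δ + 1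
    rw [g.2, L₀_rot R hR, add_assoc]⟩
  left_inv L := by
    apply Subtype.ext; funext δ
    show L.1 δ + L₀ R δ + L₀ R δ = L.1 δ
    rw [add_assoc, zmod2_add_self, add_zero]
  right_inv g := by
    apply Subtype.ext; funext δ
    show g.1 δ + L₀ R δ + L₀ R δ = g.1 δ
    rw [add_assoc, zmod2_add_self, add_zero]

/-- The torsor map, applied. [folklore] -/
theorem antiSymEquiv_apply (hR : NoFixed R) (L : AntiSym R) (δ : Dart M 3) :
    (antiSymEquiv R hR L).1 δ = L.1 δ + L₀ R δ := rfl

/-- **The total boundary of a symmetric function vanishes** (`∑_w ∂g(w) = ∑_δ g δ = 2 ∑_e g e`).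
[cite: DawarWilsenach2025, Lemma 7.6 (proof: "|E| = ∑_v in(v)")] -/
theorem sum_bd_eq_zero (hR : NoFixed R) (g : Sym R) : ∑ w, bd g.1 w = 0 := by
  have h1 : ∑ w, bd g.1 w = ∑ δ : Dart M 3, g.1 δ := by
    unfold bd
    rw [← Finset.univ_product_univ, Finset.sum_product]
  rw [h1]
  -- split into canonical darts and their reverses
  rw [← Finset.sum_filter_add_sum_filter_not univ (Canon R)]
  have h2 : ∑ δ ∈ univ.filter fun δ => ¬ Canon R δ, g.1 δ = ∑ δ ∈ univ.filter (Canon R), g.1 δ := by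
    refine Finset.sum_bij (fun δ _ => R.rot δ) (fun δ hδ => ?_) (fun δ _ δ' _ h => ?_) (fun δ hδ => ?_) (fun δ _ => (g.2 δ).symm)
    · rw [Finset.mem_filter] at hδ ⊢
      exact ⟨mem_univ _, (canon_or_canon_rot R hR δ).resolve_left hδ.2⟩
    · have := congrArg R.rot h; rwa [R.rot_rot, R.rot_rot] at this
    · refine ⟨R.rot δ, ?_, R.rot_rot δ⟩
      rw [Finset.mem_filter] at hδ ⊢
      exact ⟨mem_univ _, not_canon_rot_of_canon R hδ.2⟩
  rw [h2, ← Finset.sum_add_distrib]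
  exact Finset.sum_eq_zero fun δ _ => zmod2_add_self _

/-- The support of a `ZMod 2`-valued function on the vertices. [folklore] -/
def supp (t : Fin M → ZMod 2) : Finset (Fin M) := univ.filter fun w => t w = 1

/-- The total of a `ZMod 2`-valued function is the parity of its support. [folklore] -/
theorem sum_eq_card_supp (t : Fin M → ZMod 2) : ∑ w, t w = ((supp t).card : ZMod 2) := by
  rw [Finset.card_eq_sum_ones, Nat.cast_sum, ← Finset.sum_filter_add_sum_filter_not univ (fun w => t w = 1)]
  have h0 : ∑ w ∈ univ.filter (fun w => ¬ t w = 1), t w = 0 :=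
    Finset.sum_eq_zero fun w hw => (zmod2_eq_zero_or_one (t w)).resolve_right (Finset.mem_filter.1 hw).2
  rw [h0, add_zero]
  simp only [Nat.cast_one]
  exact Finset.sum_congr rfl fun w hw => (Finset.mem_filter.1 hw).2

variable {R}

/-- **Every even-total function is the boundary of a symmetric function** (connectivity: pair up
the support along walks). [cite: DawarWilsenach2025, Lemma 7.7 (proof: "consider any simple path from u to v … reversing the direction of every edge on this path")] -/
theorem exists_sym_bd_eq (hT : TwoLeaving R) : ∀ (n : ℕ) (t : Fin M → ZMod 2), (supp t).card ≤ n →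
    ∑ w, t w = 0 → ∃ g : Sym R, bd g.1 = t := by
  intro n
  induction n using Nat.strong_induction_on with
  | _ n ih =>
    intro t hn ht
    by_cases h0 : supp t = ∅
    · refine ⟨⟨0, fun _ => rfl⟩, ?_⟩
      rw [bd_zero]
      funext w
      symm
      refine (zmod2_eq_zero_or_one (t w)).resolve_right fun h1 => ?_
      have : w ∈ supp t := Finset.mem_filter.2 ⟨mem_univ _, h1⟩
      rw [h0] at this; simp at this
    · obtain ⟨a, ha⟩ := Finset.nonempty_iff_ne_empty.2 h0
      -- a second support point
      have hcard : 1 < (supp t).card := by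
        rw [sum_eq_card_supp] at ht
        have hpos : 0 < (supp t).card := Finset.card_pos.2 ⟨a, ha⟩
        by_contra hle
        have h1 : (supp t).card = 1 := by omega
        rw [h1] at ht; exact absurd ht (by decide)
      obtain ⟨b, hb, hba⟩ := Finset.exists_mem_ne hcard a
      -- remove `a` and `b`
      set t' : Fin M → ZMod 2 := t + Pi.single a 1 + Pi.single b 1 with ht'
      have hsupp : supp t' = ((supp t).erase a).erase b := by
        ext w
        simp only [supp, Finset.mem_filter, Finset.mem_univ, true_and, Finset.mem_erase, ht', Pi.add_apply]
        have hta := (Finset.mem_filter.1 ha).2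
        have htb := (Finset.mem_filter.1 hb).2
        by_cases hwa : w = a
        · subst hwa
          rw [Pi.single_eq_same, Pi.single_eq_of_ne (Ne.symm hba), hta]
          simp
        · by_cases hwb : w = b
          · subst hwb
            rw [Pi.single_eq_same, Pi.single_eq_of_ne hwa, htb]
            simp
          · rw [Pi.single_eq_of_ne hwa, Pi.single_eq_of_ne hwb, add_zero, add_zero]
            simp [hwa, hwb]
      have hlt : (supp t').card < n := by
        rw [hsupp]
        have h1 : ((supp t).erase a).card = (supp t).card - 1 := Finset.card_erase_of_mem ha
        have h2 : (((supp t).erase a).erase b).card = ((supp t).erase a).card - 1 :=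
          Finset.card_erase_of_mem (Finset.mem_erase.2 ⟨hba, hb⟩)
        omega
      have hsum' : ∑ w, t' w = 0 := by
        simp only [ht', Pi.add_apply, Finset.sum_add_distrib, ht, Finset.sum_pi_single', Finset.mem_univ, if_true]
        decide
      obtain ⟨g', hg'⟩ := ih _ hlt t' le_rfl hsum'
      obtain ⟨W⟩ := reachable_of_twoLeaving_empty R hT a b
      refine ⟨⟨wgauge R W + g'.1, fun δ => by rw [Pi.add_apply, Pi.add_apply, wgauge_rot, g'.2]⟩, ?_⟩
      show bd (wgauge R W + g'.1) = t
      rw [bd_add, bd_wgauge, hg', ht']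
      funext w
      simp only [Pi.add_apply]
      have ha2 := zmod2_add_self ((Pi.single a (1 : ZMod 2) : Fin M → ZMod 2) w)
      have hb2 := zmod2_add_self ((Pi.single b (1 : ZMod 2) : Fin M → ZMod 2) w)
      -- `1_a + 1_b + (t + 1_a + 1_b) = t`
      calc (Pi.single a (1 : ZMod 2) : Fin M → ZMod 2) w + (Pi.single b (1 : ZMod 2) : Fin M → ZMod 2) w +
            (t w + (Pi.single a (1 : ZMod 2) : Fin M → ZMod 2) w + (Pi.single b (1 : ZMod 2) : Fin M → ZMod 2) w)
          = t w + ((Pi.single a (1 : ZMod 2) : Fin M → ZMod 2) w + (Pi.single a (1 : ZMod 2) : Fin M → ZMod 2) w) +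
            ((Pi.single b (1 : ZMod 2) : Fin M → ZMod 2) w + (Pi.single b (1 : ZMod 2) : Fin M → ZMod 2) w) := by ring
        _ = t w := by rw [ha2, hb2, add_zero, add_zero]

/-- The kernel of the boundary on symmetric functions: the cycle space. [cite: DawarWilsenach2025, Lemma 7.8 (proof: "its kernel has size 2^{|E|/2−|V|+1}")] -/
abbrev Ker : Type := {g : Sym R // bd g.1 = 0}

/-- `Ker` is finite. [folklore] -/
instance Ker.fintype : Fintype (Ker (R := R)) := Subtype.fintype _

/-- `Ker` is non-empty (it contains `0`). [folklore] -/
theorem card_Ker_pos : 0 < Fintype.card (Ker (R := R)) :=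
  Fintype.card_pos_iff.2 ⟨⟨⟨0, fun _ => rfl⟩, bd_zero⟩⟩

/-- **The fibres of the boundary**: a total in the image has exactly `|Ker|` preimages, others
none (Lemma 7.8). [cite: DawarWilsenach2025, Lemma 7.8] -/
theorem card_fibre (hR : NoFixed R) (hT : TwoLeaving R) (t : Fin M → ZMod 2) :
    Fintype.card {g : Sym R // bd g.1 = t} = if ∑ w, t w = 0 then Fintype.card (Ker (R := R)) else 0 := by
  split_ifs with ht
  · obtain ⟨g₀, hg₀⟩ := exists_sym_bd_eq hT _ t le_rfl ht
    refine Fintype.card_congr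
      { toFun := fun g => ⟨⟨g.1.1 + g₀.1, fun δ => by rw [Pi.add_apply, Pi.add_apply, g.1.2, g₀.2]⟩, ?_⟩
        invFun := fun g => ⟨⟨g.1.1 + g₀.1, fun δ => by rw [Pi.add_apply, Pi.add_apply, g.1.2, g₀.2]⟩, ?_⟩
        left_inv := fun g => ?_
        right_inv := fun g => ?_ }
    · show bd (g.1.1 + g₀.1) = 0
      rw [bd_add, g.2, hg₀]; funext w; exact zmod2_add_self _
    · show bd (g.1.1 + g₀.1) = t
      rw [bd_add, g.2, hg₀, zero_add]
    · apply Subtype.ext; apply Subtype.ext; funext δ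
      show g.1.1 δ + g₀.1 δ + g₀.1 δ = g.1.1 δ
      rw [add_assoc, zmod2_add_self, add_zero]
    · apply Subtype.ext; apply Subtype.ext; funext δ
      show g.1.1 δ + g₀.1 δ + g₀.1 δ = g.1.1 δ
      rw [add_assoc, zmod2_add_self, add_zero]
  · rw [Fintype.card_eq_zero_iff]
    refine ⟨fun g => ht ?_⟩
    rw [← g.2]
    exact sum_bd_eq_zero R hR g.1

/-- **Summing a function of the boundary over the edge space** = `|Ker|` times the sum over the
even totals. [cite: DawarWilsenach2025, Lemma 7.8 ("By linearity, the pre-image of any vector in the image has exactly this size")] -/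
theorem sum_sym_eq (hR : NoFixed R) (hT : TwoLeaving R) (G : (Fin M → ZMod 2) → ℤ) :
    ∑ g : Sym R, G (bd g.1) = Fintype.card (Ker (R := R)) * ∑ t : Fin M → ZMod 2, (if ∑ w, t w = 0 then G t else 0) := by
  classical
  have h1 : ∑ g : Sym R, G (bd g.1) = ∑ t : Fin M → ZMod 2, ∑ g ∈ univ.filter (fun g : Sym R => bd g.1 = t), G (bd g.1) := by
    rw [← Finset.sum_fiberwise_of_maps_to (g := fun g : Sym R => bd g.1) (t := univ) (fun _ _ => mem_univ _)]
  rw [h1, Finset.mul_sum]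
  refine Finset.sum_congr rfl fun t _ => ?_
  have h2 : ∑ g ∈ univ.filter (fun g : Sym R => bd g.1 = t), G (bd g.1) =
      ∑ g ∈ univ.filter (fun g : Sym R => bd g.1 = t), G t :=
    Finset.sum_congr rfl fun g hg => by rw [(Finset.mem_filter.1 hg).2]
  rw [h2, Finset.sum_const, nsmul_eq_mul]
  have h3 : (univ.filter (fun g : Sym R => bd g.1 = t)).card = Fintype.card {g : Sym R // bd g.1 = t} :=
    (Fintype.card_subtype _).symm
  rw [h3, card_fibre hR hT]
  split_ifs <;> simp

end Sym


/-! ### Lemma 7.9 and the proof of Theorem 7.2: the counts differ -/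

section Final

variable (R)

/-- The odd indicator of a labelling: the parity of the labels of the three darts at `w`. [cite: DawarWilsenach2025, §7.2 ("v is odd with respect to an orientation if it has an odd number of incoming edges")] -/
def odf (L : Dart M 3 → ZMod 2) : Fin M → ZMod 2 := fun w => L (w, 0) + L (w, 1) + L (w, 2)

/-- The odd indicator is the boundary. [folklore] -/
theorem odf_eq_bd (L : Dart M 3 → ZMod 2) : odf L = bd L := by
  funext w; simp [odf, bd, Fin.sum_univ_three]

/-- The odd indicator is additive. [folklore] -/
theorem odf_add (L L' : Dart M 3 → ZMod 2) : odf (L + L') = odf L + odf L' := by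
  rw [odf_eq_bd, odf_eq_bd, odf_eq_bd, bd_add]

/-- **The number of uniform matchings with labelling `L`** (product of the local counts).
[cite: DawarWilsenach2025, §7.2 (p. 24: "the number of uniform perfect matchings M with →Γ_M = →Γ is 2^{|odd|} 4^{|V|−|odd|}")] -/
theorem card_UL_eq (hR : NoFixed R) {L : Dart M 3 → ZMod 2} (hL : ∀ δ, L (R.rot δ) = L δ + 1) (c : Fin M → ZMod 2) :
    (Fintype.card (UL R c L) : ℤ) = ∏ w, (if odf L w = c w then 4 else 2 : ℤ) := by
  rw [card_UL R hR hL, Nat.cast_prod]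
  refine Finset.prod_congr rfl fun w _ => ?_
  rw [card_LocF]
  unfold odf
  split_ifs <;> simp

/-- The sign character of `ZMod 2`. [folklore] -/
def χ (a : ZMod 2) : ℤ := if a = 0 then 1 else -1

/-- The weight `2 − a`. [folklore] -/
def ν (a : ZMod 2) : ℤ := if a = 0 then 2 else 1

/-- `χ` is multiplicative. [folklore] -/
theorem χ_add (a b : ZMod 2) : χ (a + b) = χ a * χ b := by revert a b; decide

/-- `χ` of a sum is the product of the `χ`. [folklore] -/
theorem χ_sum {ι : Type*} (s : Finset ι) (f : ι → ZMod 2) : χ (∑ i ∈ s, f i) = ∏ i ∈ s, χ (f i) := by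
  induction s using Finset.induction_on with
  | empty => simp [χ]
  | insert a s ha ih => rw [Finset.sum_insert ha, Finset.prod_insert ha, χ_add, ih]

/-- `χ ≠ 0`. [folklore] -/
theorem χ_ne_zero (a : ZMod 2) : χ a ≠ 0 := by unfold χ; split_ifs <;> norm_num

/-- The SIGNED WEIGHT of a parity vector relative to the special vertex `x`. [folklore] -/
def Fx (x : Fin M) (u : Fin M → ZMod 2) : ℤ := χ (u x) * ∏ w ∈ univ.erase x, ν (u w)

variable (x : Fin M)

/-- **The difference of the uniform counts for one labelling** (`X(Γ)` versus `X̃_x(Γ)`):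
`2^M · Fx(odd(L))`. [cite: DawarWilsenach2025, §7.2 (p. 24: the number of uniform matchings of X̃(Γ) "depends on whether the special vertex x is odd")] -/
theorem diff_uniform (L : Dart M 3 → ZMod 2) :
    (∏ w, (if odf L w = (0 : Fin M → ZMod 2) w then 4 else 2 : ℤ)) -
      ∏ w, (if odf L w = (Pi.single x 1 : Fin M → ZMod 2) w then 4 else 2 : ℤ) = 2 ^ M * Fx x (odf L) := by
  rw [← Finset.mul_prod_erase univ _ (mem_univ x), ← Finset.mul_prod_erase univ _ (mem_univ x)]
  have hP : ∀ s : Fin M → ZMod 2, s = 0 ∨ s = Pi.single x 1 →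
      ∏ w ∈ univ.erase x, (if odf L w = s w then 4 else 2 : ℤ) = 2 ^ (M - 1) * ∏ w ∈ univ.erase x, ν (odf L w) := by
    intro s hs
    have : ∀ w ∈ univ.erase x, (if odf L w = s w then 4 else 2 : ℤ) = 2 * ν (odf L w) := by
      intro w hw
      have hsw : s w = 0 := by
        rcases hs with rfl | rfl
        · rfl
        · exact Pi.single_eq_of_ne (Finset.ne_of_mem_erase hw) _
      rw [hsw]; unfold ν; split_ifs <;> norm_num
    rw [Finset.prod_congr rfl this, Finset.prod_mul_distrib, Finset.prod_const, Finset.card_erase_of_mem (mem_univ x),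
      Finset.card_univ, Fintype.card_fin]
  rw [hP 0 (Or.inl rfl), hP _ (Or.inr rfl), Pi.zero_apply, Pi.single_eq_same]
  have hx : (if odf L x = 0 then 4 else 2 : ℤ) - (if odf L x = 1 then 4 else 2 : ℤ) = 2 * χ (odf L x) := by
    unfold χ
    rcases zmod2_eq_zero_or_one (odf L x) with h | h <;> rw [h] <;> decide
  have hM : (2 : ℤ) ^ M = 2 * 2 ^ (M - 1) := by
    rw [← pow_succ']; congr 1; have := x.2; omega
  rw [hM, Fx]
  linear_combination (2 : ℤ) ^ (M - 1) * (∏ w ∈ univ.erase x, ν (odf L w)) * hx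

/-- `Fx` as a product over all vertices. [folklore] -/
theorem Fx_eq_prod (u : Fin M → ZMod 2) : Fx x u = ∏ w, (if w = x then χ (u w) else ν (u w)) := by
  rw [Fx, ← Finset.mul_prod_erase univ _ (mem_univ x), if_pos rfl]
  congr 1
  exact Finset.prod_congr rfl fun w hw => by rw [if_neg (Finset.ne_of_mem_erase hw)]

/-- **Sum over ALL parity vectors of `Fx`: zero** (the `x`-factor sums to `χ 0 + χ 1 = 0`). [folklore] -/
theorem sum_Fx : ∑ u : Fin M → ZMod 2, Fx x u = 0 := by
  simp_rw [Fx_eq_prod]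
  rw [← Fintype.piFinset_univ, ← Finset.prod_univ_sum (fun _ => (univ : Finset (ZMod 2)))
    (fun w a => if w = x then χ a else ν a)]
  apply Finset.prod_eq_zero (mem_univ x)
  simp only [if_true]
  decide

/-- **Sum over all parity vectors of `χ(∑ u) · Fx u`: two.** [folklore] -/
theorem sum_χ_Fx : ∑ u : Fin M → ZMod 2, χ (∑ w, u w) * Fx x u = 2 := by
  have h1 : ∀ u : Fin M → ZMod 2, χ (∑ w, u w) * Fx x u = ∏ w, (if w = x then χ (u w) * χ (u w) else χ (u w) * ν (u w)) := by
    intro u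
    rw [χ_sum, Fx_eq_prod, ← Finset.prod_mul_distrib]
    exact Finset.prod_congr rfl fun w _ => by split_ifs <;> rfl
  simp_rw [h1]
  rw [← Fintype.piFinset_univ, ← Finset.prod_univ_sum (fun _ => (univ : Finset (ZMod 2)))
    (fun w a => if w = x then χ a * χ a else χ a * ν a)]
  rw [← Finset.mul_prod_erase univ _ (mem_univ x)]
  simp only [if_true]
  have h2 : ∏ w ∈ univ.erase x, ∑ a : ZMod 2, (if w = x then χ a * χ a else χ a * ν a) = 1 := by
    refine Finset.prod_eq_one fun w hw => ?_
    simp only [if_neg (Finset.ne_of_mem_erase hw)]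
    decide
  rw [h2]; decide

/-- **Lemma 7.9 (signed form): the sum of `Fx` over the parity vectors of a fixed total is `±1`.**
[cite: DawarWilsenach2025, Lemma 7.9] -/
theorem sum_Fx_fixed_total (π₀ : ZMod 2) :
    ∑ u : Fin M → ZMod 2, (if ∑ w, u w = π₀ then Fx x u else 0) = χ π₀ := by
  -- `2 · [a = π₀] = 1 + χ (a + π₀)`
  have hind : ∀ a : ZMod 2, (2 : ℤ) * (if a = π₀ then 1 else 0) = 1 + χ a * χ π₀ := by
    intro a; revert a π₀; decide
  have h2 : (2 : ℤ) * ∑ u : Fin M → ZMod 2, (if ∑ w, u w = π₀ then Fx x u else 0) =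
      ∑ u : Fin M → ZMod 2, Fx x u + χ π₀ * ∑ u : Fin M → ZMod 2, χ (∑ w, u w) * Fx x u := by
    rw [Finset.mul_sum, Finset.mul_sum, ← Finset.sum_add_distrib]
    refine Finset.sum_congr rfl fun u _ => ?_
    have := hind (∑ w, u w)
    split_ifs at this ⊢ with h
    · linear_combination (Fx x u) * this
    · linear_combination (Fx x u) * this
  rw [sum_Fx, sum_χ_Fx] at h2
  linarith

variable {R}

/-- **The signed sum over all orientations** equals `|Ker| · χ(π₀)` with `π₀` the total of the
reference orientation. [cite: DawarWilsenach2025, Lemmas 7.8–7.9] -/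
theorem sum_antiSym_Fx (hR : NoFixed R) (hT : TwoLeaving R) :
    ∑ L : AntiSym R, Fx x (odf L.1) = Fintype.card (Ker (R := R)) * χ (∑ w, odf (L₀ R) w) := by
  -- reindex over the edge space
  have h1 : ∑ L : AntiSym R, Fx x (odf L.1) = ∑ g : Sym R, Fx x (odf (L₀ R) + bd g.1) := by
    rw [← Equiv.sum_comp (antiSymEquiv R hR).symm]
    refine Finset.sum_congr rfl fun g _ => ?_
    congr 1
    have : ((antiSymEquiv R hR).symm g).1 = g.1 + L₀ R := rfl
    rw [this, odf_add, odf_eq_bd g.1, add_comm]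
  rw [h1, sum_sym_eq hR hT (fun t => Fx x (odf (L₀ R) + t))]
  congr 1
  -- translate by `odf L₀`
  have h2 : ∑ t : Fin M → ZMod 2, (if ∑ w, t w = 0 then Fx x (odf (L₀ R) + t) else 0) =
      ∑ u : Fin M → ZMod 2, (if ∑ w, u w = ∑ w, odf (L₀ R) w then Fx x u else 0) := by
    symm
    rw [← Equiv.sum_comp (Equiv.addLeft (odf (L₀ R)))]
    refine Finset.sum_congr rfl fun t _ => ?_
    simp only [Equiv.coe_addLeft, Pi.add_apply, Finset.sum_add_distrib, add_eq_left]
  rw [h2, sum_Fx_fixed_total]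

/-- The uniform perfect matchings, fibred over their labellings. [folklore] -/
theorem card_uniform_eq_sum (hR : NoFixed R) (c : Fin M → ZMod 2) :
    Fintype.card {τ : PMI R c // τ.IsUniform} = ∑ L : AntiSym R, Fintype.card (UL R c L.1) := by
  rw [← Fintype.card_sigma]
  refine Fintype.card_congr
    { toFun := fun τ => ⟨⟨τ.1.lab, τ.1.lab_rot hR τ.2⟩, ⟨τ.1, τ.2, rfl⟩⟩
      invFun := fun Lτ => ⟨Lτ.2.1, Lτ.2.2.1⟩
      left_inv := fun τ => rfl
      right_inv := fun Lτ => ?_ }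
  obtain ⟨L, τ, hu, hlab⟩ := Lτ
  have hL : L = ⟨τ.lab, τ.lab_rot hR hu⟩ := Subtype.ext hlab.symm
  subst hL
  rfl

/-- **The difference of the numbers of perfect matchings of `X(Γ) = M(R, 0)` and
`X̃_x(Γ) = M(R, 1_x)`** is `± 2^M · |Ker|`. [cite: DawarWilsenach2025, Thm 7.2 (proof: "|μ(X(Γ)) − μ(X̃(Γ))| = 2^{3n+1}")] -/
theorem card_PMI_sub (hR : NoFixed R) (hT : TwoLeaving R) :
    (Fintype.card (PMI R 0) : ℤ) - Fintype.card (PMI R (Pi.single x 1)) =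
      2 ^ M * (Fintype.card (Ker (R := R)) * χ (∑ w, odf (L₀ R) w)) := by
  have hsplit : ∀ c : Fin M → ZMod 2, (Fintype.card (PMI R c) : ℤ) =
      Fintype.card {τ : PMI R c // τ.IsUniform} + Fintype.card {τ : PMI R c // ¬ τ.IsUniform} := by
    intro c
    rw [Fintype.card_subtype_compl, Nat.cast_sub (Fintype.card_subtype_le _)]
    ring
  have hU : ∀ c : Fin M → ZMod 2, (Fintype.card {τ : PMI R c // τ.IsUniform} : ℤ) =
      ∑ L : AntiSym R, ∏ w, (if odf L.1 w = c w then 4 else 2 : ℤ) := by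
    intro c
    rw [card_uniform_eq_sum hR, Nat.cast_sum]
    exact Finset.sum_congr rfl fun L _ => card_UL_eq R hR L.2 c
  have hN : (Fintype.card {τ : PMI R 0 // ¬ τ.IsUniform} : ℤ) =
      Fintype.card {τ : PMI R (Pi.single x 1) // ¬ τ.IsUniform} := by
    exact_mod_cast card_nonuniform_eq hT x hR (c := 0) (c' := Pi.single x 1) (by rw [zero_add])
  rw [hsplit, hsplit, hU, hU, hN, add_sub_add_right_eq_sub, ← Finset.sum_sub_distrib,
    Finset.sum_congr rfl fun L _ => diff_uniform x L.1, ← Finset.mul_sum, sum_antiSym_Fx x hR hT]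

/-- **Theorem 7.2, the count: `X(Γ)` and `X̃(Γ)` have different numbers of perfect matchings.**
[cite: DawarWilsenach2025, Thm 7.2 ("μ(X) − μ(Y) = 2^ℓ for some ℓ")] -/
theorem card_PMI_ne (hR : NoFixed R) (hT : TwoLeaving R) :
    Fintype.card (PMI R 0) ≠ Fintype.card (PMI R (Pi.single x 1)) := by
  intro h
  have := card_PMI_sub x hR hT
  rw [h, sub_self] at this
  have hK : (0 : ℤ) < Fintype.card (Ker (R := R)) := by exact_mod_cast card_Ker_pos
  have hχ := χ_ne_zero (∑ w, odf (L₀ R) w)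
  exact mul_ne_zero (pow_ne_zero _ two_ne_zero) (mul_ne_zero hK.ne' hχ) this.symm

/-- Perfect matchings (as partner maps, `Literature.Probability.LatticeModels.perfectMatchingEquivPartner`)
are the elements of `PMI`. [folklore] -/
def partnerEquivPMI (c : Fin M → ZMod 2) :
    {f : MVert M → MVert M // ∀ v, (mgraph R c).Adj v (f v) ∧ f (f v) = v} ≃ PMI R c where
  toFun f := ⟨Function.Involutive.toPerm f.1 (fun v => (f.2 v).2), f.2⟩
  invFun τ := ⟨τ.1, τ.2⟩
  left_inv _ := rfl
  right_inv _ := Subtype.ext (Equiv.ext fun _ => rfl)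

/-- **In terms of perfect matchings (subgraphs)**: `M(R, 0)` and `M(R, 1_x)` have different numbers
of perfect matchings. [cite: DawarWilsenach2025, Thm 7.2] -/
theorem card_perfectMatchings_ne (hR : NoFixed R) (hT : TwoLeaving R) :
    Nat.card {P : (mgraph R 0).Subgraph // P.IsPerfectMatching} ≠
      Nat.card {P : (mgraph R (Pi.single x 1)).Subgraph // P.IsPerfectMatching} := by
  rw [Nat.card_congr ((Literature.Probability.LatticeModels.perfectMatchingEquivPartner _).trans (partnerEquivPMI 0)),
    Nat.card_congr ((Literature.Probability.LatticeModels.perfectMatchingEquivPartner _).trans (partnerEquivPMI _)),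
    Nat.card_eq_fintype_card, Nat.card_eq_fintype_card]
  exact card_PMI_ne x hR hT

end Final


end Literature.ModelTheory.FiniteModelTheory.CFIMatching
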